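import Literature.Computability.Cryptography.SchemesOWF
import Literature.Computability.Complexity.PlumbingBricks
import Literature.Computability.Complexity.IterateFPGrowth
import Literature.Computability.Complexity.CountingHierarchyProofs
import HarnessLib

/-!
# Private-key encryption ⇒ one-way functions (Impagliazzo–Luby 1989, Thm. 1): the machines

This file (Parts VII–IX below, each with its own section docstring) proves the machine facts used
by `SKEOWF.Params.isOneWay_F` (`SchemesOWF.lean`): the block function, the candidate `F` and the
distinguisher's run function are polynomial-time, as pipelines of the tree's plumbing bricks.
The assembly is `SchemesProofs.lean`.
-/


/-!
# Private-key encryption ⇒ one-way functions, VII: the block function is polynomial-time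

Seventh file of the discharge of `OWFExist_of_secureSKEExist` (Impagliazzo–Luby 1989, Thm. 1); see
`SchemesOWF.lean`, Part I (architecture) and `SchemesOWF.lean`, Part II (`Params.blockFn`). No machine is
programmed: as in `YaoFunProgram.lean`, the block function is written as a pipeline of the
plumbing bricks (`PlumbingBricks.lean`, `BrickAlgebra.lean`) around two clocked loops, given the
two machines of the scheme as bricks:

* `keyFn ⟨1ⁿ, s⟩ = G(1ⁿ; s)` and `encFn ⟨k, ⟨m, r⟩⟩ = E(k, m; r)` (`keyFn_mem_FP`, `encFn_mem_FP`,
  from `IsEfficient` by `PolyTimeComputable.comp_holds`);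
* `BProg.nOfFn u = 1^{nOf |u|}` (a clocked search, as `Yao.GProg.nOfFn`);
* the digits `σ̂, λ̂, ρ̂` of `|u| - B(n)^6` (`modLenFn`, `divModFn`), the pieces `b, s, rest` of `u`;
* the encryption loop on the state
  `⟨1^{LB}, ⟨k, ⟨1^{ρ̂}, ⟨1^{L}, ⟨[b], ⟨1^{fuel}, ⟨1ᵗ, ⟨rest, acc⟩⟩⟩⟩⟩⟩⟩⟩`
  (`BProg.roundFn`: while fuel lasts, encrypt the `t`-th plaintext of `M_b(n)` with the next `ρ̂`
  coins and append its frame to `acc`; a truncation to the budget `LB(|u|)` makes the growth linear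
  on all words and is invisible on genuine states; `iterate_mem_FP_of_growth`);
* `BProg.blockFnP_eq`: the pipeline computes `Params.blockFn`; `blockFn_mem_FP`.

## References

* O. Goldreich, *Foundations of Cryptography II*, CUP 2004, §5.5 Exercise 2 ("polynomial-time
  constructible ensembles"); *Foundations of Cryptography I*, CUP 2001, §2.3.1.
* S. Arora, B. Barak, *Computational Complexity: A Modern Approach*, CUP 2009, §1.3, §1.4.1.
-/

namespace Literature.Computability.Cryptography

namespace SKEOWF

open _root_.Computability Polynomial Complexity Complexity.Plumb Complexity.Brick Complexity.OracleCompose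

noncomputable section

/-! ### Output-length bounds of polynomial-time functions with encoders -/

/-- A polynomial-time function has polynomially bounded encoded output length (general-encoder
form of `exists_poly_length_le_of_mem_FP`). [Arora–Barak 2009, §1.3] [folklore] -/
theorem exists_poly_length_le_of_polyTime {α β : Type} {ea : α → List Bool} {eb : β → List Bool} {f : α → β}
    (hf : PolyTimeComputable ea eb f) : ∃ s : Polynomial ℕ, ∀ a, (eb (f a)).length ≤ s.eval (ea a).length := by
  obtain ⟨p, M, hM⟩ := hf
  refine ⟨X + C (TM2Comp.machinePushBound M.tm) * p, fun a => ?_⟩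
  have h := (hM a).length_le
  simpa using h

/-! ### The scheme's machines as bricks -/

/-- Transport of an `FP` string function to a `PolyTimeComputable` function with an output
encoder: if `F z = eb (g z)` for all `z` then `g` is polynomial-time for `(id, eb)`. [folklore] -/
theorem polyTime_of_mem_FP {β : Type} {F : List Bool → List Bool} (h : F ∈ FP) {eb : β → List Bool} {g : List Bool → β}
    (hF : ∀ z, F z = eb (g z)) : PolyTimeComputable (id : List Bool → List Bool) eb g := by
  obtain ⟨p, M, hM⟩ := h
  refine ⟨p, M, fun z => ?_⟩
  have := hM z
  rwa [show (id (F z) : List Bool) = eb (g z) from hF z] at this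

/-- `unaryEncodeNat m = 1ᵐ`. [folklore] -/
theorem unaryEncodeNat_eq_ones (m : ℕ) : unaryEncodeNat m = ones m := Complexity.unaryEncodeNat_eq_replicate m

/-- Key generation as a string function: `keyFn ⟨u, s⟩ = G(1^{|u|}; s)`. [Goldreich 2004, Def. 5.1.1] [folklore] -/
def keyFn (S : SKEScheme) (z : List Bool) : List Bool := S.keyGen.run (fstF z).length (sndF z)

/-- `keyFn ⟨u, s⟩ = G(1^{|u|}; s)`. [folklore] -/
@[simp] theorem keyFn_boolPair (S : SKEScheme) (u s : List Bool) : keyFn S (boolPair u s) = S.keyGen.run u.length s := by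
  simp [keyFn, fstF, sndF]

/-- **`keyFn ∈ FP`** for an efficient scheme: the key generator's machine after the plumbing
`z ↦ ⟨1^{|fst z|}, snd z⟩`. [Goldreich 2004, Def. 5.1.1; Arora–Barak 2009, §1.3] [folklore] -/
theorem keyFn_mem_FP {S : SKEScheme} (hG : S.keyGen.IsPolyTime unaryEncodeNat (id : List Bool → List Bool)) : keyFn S ∈ FP := by
  have h1 : PolyTimeComputable (id : List Bool → List Bool) (fun p : ℕ × List Bool => boolPair (unaryEncodeNat p.1) p.2)
      (fun z : List Bool => ((fstF z).length, sndF z)) :=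
    polyTime_of_mem_FP (fanoutFn_mem_FP (comp_mem_FP onesFn_mem_FP fstF_mem_FP) sndF_mem_FP) fun z => by
      simp [onesFn]
  exact PolyTimeComputable.comp_holds hG.1 h1

/-- Encryption as a string function: `encFn ⟨k, ⟨m, r⟩⟩ = E(k, m; r)`. [Goldreich 2004, Def. 5.1.1] [folklore] -/
def encFn (S : SKEScheme) (z : List Bool) : List Bool := S.enc.run (nthF 0 z, nthF 1 z) (sndPow 1 z)

/-- `encFn ⟨k, ⟨m, r⟩⟩ = E(k, m; r)`. [folklore] -/
@[simp] theorem encFn_boolPair (S : SKEScheme) (k m r : List Bool) : encFn S (boolPair k (boolPair m r)) = S.enc.run (k, m) r := by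
  simp [encFn]

/-- **`encFn ∈ FP`** for an efficient scheme. [Goldreich 2004, Def. 5.1.1; Arora–Barak 2009, §1.3] [folklore] -/
theorem encFn_mem_FP {S : SKEScheme} (hE : S.enc.IsPolyTime pairCode (id : List Bool → List Bool)) : encFn S ∈ FP := by
  have h1 : PolyTimeComputable (id : List Bool → List Bool) (fun p : (List Bool × List Bool) × List Bool => boolPair (pairCode p.1) p.2)
      (fun z : List Bool => ((nthF 0 z, nthF 1 z), sndPow 1 z)) :=
    polyTime_of_mem_FP (fanoutFn_mem_FP (fanoutFn_mem_FP (nthF_mem_FP 0) (nthF_mem_FP 1)) (sndPow_mem_FP 1)) fun z => by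
      simp [pairCode]
  exact PolyTimeComputable.comp_holds hE.1 h1

namespace BProg

variable (P : Params)

/-! ### The parameter `nOf |u|` by a clocked search -/

/-- The search bound polynomial `B(k+1)^6`. [folklore] -/
def B6succ : Polynomial ℕ := (P.Bpoly.comp (X + 1)) ^ 6

/-- Value of `B6succ`. [folklore] -/
@[simp] theorem B6succ_eval (k : ℕ) : (B6succ P).eval k = P.B (k + 1) ^ 6 := by simp [B6succ, Params.B]

/-- The search step: `k ↦ k + 1` while `B(k+1)^6 ≤ j`. [folklore] -/
def nstep (j k : ℕ) : ℕ := if P.B (k + 1) ^ 6 ≤ j then k + 1 else k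

/-- The stop condition `[|u| + 1 ≤ B(k+1)^6]` on the state `⟨u, 1ᵏ⟩`. [folklore] -/
def nOfCond : List Bool → List Bool := lenLeFn (B6succ P) ∘ fanoutFn sndF (List.cons true ∘ fstF)

/-- One round of the search. [folklore] -/
def nOfRound : List Bool → List Bool := fanoutFn fstF (iteFn (nOfCond P) sndF (List.cons true ∘ sndF))

/-- Value of the condition. [folklore] -/
theorem nOfCond_state (u : List Bool) (k : ℕ) : nOfCond P (boolPair u (ones k)) = [decide (u.length + 1 ≤ P.B (k + 1) ^ 6)] := by
  simp [nOfCond, lenLeFn_boolPair]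

/-- Value of the round. [folklore] -/
theorem nOfRound_state (u : List Bool) (k : ℕ) : nOfRound P (boolPair u (ones k)) = boolPair u (ones (nstep P u.length k)) := by
  unfold nOfRound nstep
  rw [fanoutFn_apply, fstF_boolPair]
  by_cases h : P.B (k + 1) ^ 6 ≤ u.length
  · rw [iteFn_apply_false (by rw [nOfCond_state, decide_eq_false (by omega)]), if_pos h]
    simp [List.replicate_succ]
  · rw [iteFn_apply_true (by rw [nOfCond_state, decide_eq_true (by omega)]), if_neg h]
    simp

/-- Additive growth of the round. [folklore] -/
theorem length_nOfRound_le (w : List Bool) : (nOfRound P w).length ≤ w.length + 3 := by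
  have h1 := length_boolUnpair_parts_le w
  unfold nOfRound
  rcases lenLeFn_eq_or (B6succ P) (fanoutFn sndF (List.cons true ∘ fstF) w) with h | h
  · rw [fanoutFn_apply, iteFn_apply_true (by simpa [nOfCond] using h)]
    simp only [length_boolPair, fstF, sndF]; omega
  · rw [fanoutFn_apply, iteFn_apply_false (by simpa [nOfCond] using h)]
    simp only [length_boolPair, fstF, sndF, Function.comp_apply, List.length_cons]; omega

/-- **The search computes `nOf`**: after `i ≤ j` rounds the counter is `min i (nOf j)`. [folklore] -/
theorem iterate_nstep (j : ℕ) : ∀ i, i ≤ j → (nstep P j)^[i] 0 = min i (P.nOf j)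
  | 0, _ => by simp
  | i + 1, hi => by
    rw [Function.iterate_succ_apply', iterate_nstep j i (by omega)]
    have hGj : P.nOf j ≤ j := Nat.findGreatest_le j
    have hG2 : ∀ n, P.nOf j < n → n ≤ j → ¬ P.B n ^ 6 ≤ j := fun n h1 h2 =>
      Nat.findGreatest_is_greatest (P := fun k => P.B k ^ 6 ≤ j) h1 h2
    unfold nstep
    by_cases hiG : i < P.nOf j
    · have hG0 : P.nOf j ≠ 0 := by omega
      have hG1 : P.B (P.nOf j) ^ 6 ≤ j := Nat.findGreatest_of_ne_zero (P := fun k => P.B k ^ 6 ≤ j) (n := j) rfl hG0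
      have hmono : P.B (i + 1) ^ 6 ≤ P.B (P.nOf j) ^ 6 := Nat.pow_le_pow_left (P.B_mono (by omega)) 6
      rw [min_eq_left hiG.le, if_pos (hmono.trans hG1), min_eq_left (by omega)]
    · rw [min_eq_right (by omega), if_neg (hG2 _ (by omega) (by omega)), min_eq_right (by omega)]

/-- Rounds of the search on a state. [folklore] -/
theorem iterate_nOfRound (u : List Bool) : ∀ i, (nOfRound P)^[i] (boolPair u (ones 0)) = boolPair u (ones ((nstep P u.length)^[i] 0))
  | 0 => rfl
  | i + 1 => by rw [Function.iterate_succ_apply', iterate_nOfRound u i, nOfRound_state, Function.iterate_succ_apply']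

/-- **`nOfFn u = 1^{nOf |u|}`.** [folklore] -/
def nOfFn : List Bool → List Bool :=
  sndF ∘ (fun z => (nOfRound P)^[X.eval (boolUnpair z).1.length] z) ∘ fanoutFn id (fun _ => [])

/-- Value of `nOfFn`. [folklore] -/
@[simp] theorem nOfFn_apply (u : List Bool) : nOfFn P u = ones (P.nOf u.length) := by
  have h := iterate_nOfRound P u u.length
  have hle : P.nOf u.length ≤ u.length := Nat.findGreatest_le _
  rw [iterate_nstep P u.length u.length le_rfl, min_eq_right hle] at h
  simp only [nOfFn, Function.comp_apply, fanoutFn_apply, id, boolUnpair_boolPair, eval_X]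
  rw [show (boolPair u [] : List Bool) = boolPair u (ones 0) from rfl, h, sndF_boolPair]

/-- `nOfFn ∈ FP`. [folklore] -/
theorem nOfFn_mem_FP : nOfFn P ∈ FP :=
  comp_mem_FP sndF_mem_FP (comp_mem_FP
    (iterate_mem_FP (fanoutFn_mem_FP fstF_mem_FP (iteFn_mem_FP
      (comp_mem_FP (lenLeFn_mem_FP _) (fanoutFn_mem_FP sndF_mem_FP (comp_mem_FP (cons_mem_FP true) fstF_mem_FP)))
      sndF_mem_FP (comp_mem_FP (cons_mem_FP true) sndF_mem_FP))) 3 (length_nOfRound_le P) X)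
    (fanoutFn_mem_FP OracleCompose.id_mem_FP (const_mem_FP [])))

/-! ### The header `⟨u, 1ⁿ⟩` and the decoded quantities -/

/-- The header `⟨u, 1ⁿ⟩`, `n = nOf |u|`. [folklore] -/
def hdrFn : List Bool → List Bool := fanoutFn id (nOfFn P)

/-- Value of the header. [folklore] -/
@[simp] theorem hdrFn_apply (u : List Bool) : hdrFn P u = boolPair u (ones (P.nOf u.length)) := by simp [hdrFn]

/-- `hdrFn ∈ FP`. [folklore] -/
theorem hdrFn_mem_FP : hdrFn P ∈ FP := fanoutFn_mem_FP OracleCompose.id_mem_FP (nOfFn_mem_FP P)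

section OnHeader

/-! All the following bricks read the header `h = ⟨u, 1ⁿ⟩`. -/

/-- `1^{B(n)}`. [folklore] -/
def bFn : List Bool → List Bool := polyFn P.Bpoly ∘ sndF
/-- `1^{B(n)^2}`. [folklore] -/
def b2Fn : List Bool → List Bool := polyFn (P.Bpoly ^ 2) ∘ sndF
/-- `1^{B(n)^3}`. [folklore] -/
def b3Fn : List Bool → List Bool := polyFn (P.Bpoly ^ 3) ∘ sndF
/-- `1^{B(n)^6}`. [folklore] -/
def b6Fn : List Bool → List Bool := polyFn (P.Bpoly ^ 6) ∘ sndF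
/-- `1^{d}`, `d = |u| - B(n)^6`. [folklore] -/
def dFn : List Bool → List Bool := onesFn ∘ dropFn ∘ fanoutFn (b6Fn P) fstF
/-- The bit `[B(n)^3 ≤ d]` (digits out of range). [folklore] -/
def badFn : List Bool → List Bool := lenLeFn X ∘ fanoutFn (dFn P) (b3Fn P)
/-- `1^{σ̂}`, `σ̂ = d mod B`. [folklore] -/
def sigFn : List Bool → List Bool := modLenFn ∘ fanoutFn (bFn P) (dFn P)
/-- `1^{λ̂}`, `λ̂ = (d / B) mod B`. [folklore] -/
def lamFn : List Bool → List Bool := modLenFn ∘ fanoutFn (bFn P) (fstF ∘ divModFn ∘ fanoutFn (bFn P) (dFn P))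
/-- `1^{ρ̂}`, `ρ̂ = d / B²`. [folklore] -/
def rhoFn : List Bool → List Bool := fstF ∘ divModFn ∘ fanoutFn (b2Fn P) (dFn P)
/-- The bit `[u starts with 1]` (`= u.headD false`). [folklore] -/
def bitFn : List Bool → List Bool := eqPairFn ∘ fanoutFn (takeFn ∘ fanoutFn (fun _ => ones 1) fstF) (fun _ => [true])
/-- The seed `s = u[1, 1 + σ̂)`. [folklore] -/
def seedFn : List Bool → List Bool := takeFn ∘ fanoutFn (sigFn P) (dropFn ∘ fanoutFn (fun _ => ones 1) fstF)
/-- The coins `rest = u ⇂ (1 + σ̂)`. [folklore] -/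
def restFn : List Bool → List Bool := dropFn ∘ fanoutFn (List.cons true ∘ sigFn P) fstF
/-- The key `k = G(1ⁿ; s)`. [folklore] -/
def kFn : List Bool → List Bool := keyFn P.S ∘ fanoutFn sndF (seedFn P)
/-- The bit `[|k| = λ̂]`. [folklore] -/
def klenFn : List Bool → List Bool := eqPairFn ∘ fanoutFn (onesFn ∘ kFn P) (lamFn P)
/-- `1^{L(n)}`. [folklore] -/
def lFn : List Bool → List Bool := polyFn P.Lpoly ∘ sndF
/-- `1^{T(n)}`. [folklore] -/
def tFn : List Bool → List Bool := polyFn (2 * P.Lpoly) ∘ sndF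

variable (u : List Bool)

/-- Abbreviations for the decoded numbers at `u`. [folklore] -/
def nU : ℕ := P.nOf u.length
/-- `d = |u| - B(n)^6`. [folklore] -/
def dU : ℕ := u.length - P.B (nU P u) ^ 6
/-- `σ̂`. [folklore] -/
def sigU : ℕ := dU P u % P.B (nU P u)
/-- `λ̂`. [folklore] -/
def lamU : ℕ := dU P u / P.B (nU P u) % P.B (nU P u)
/-- `ρ̂`. [folklore] -/
def rhoU : ℕ := dU P u / P.B (nU P u) ^ 2
/-- The seed. [folklore] -/
def seedU : List Bool := (u.drop 1).take (sigU P u)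
/-- The key. [folklore] -/
def keyU : List Bool := P.S.keyGen.run (nU P u) (seedU P u)

/-- Value of `bFn`. [folklore] -/
@[simp] theorem bFn_hdr : bFn P (boolPair u (ones (P.nOf u.length))) = ones (P.B (nU P u)) := by simp [bFn, nU, Params.B]
/-- Value of `b2Fn`. [folklore] -/
@[simp] theorem b2Fn_hdr : b2Fn P (boolPair u (ones (P.nOf u.length))) = ones (P.B (nU P u) ^ 2) := by simp [b2Fn, nU, Params.B]
/-- Value of `b3Fn`. [folklore] -/
@[simp] theorem b3Fn_hdr : b3Fn P (boolPair u (ones (P.nOf u.length))) = ones (P.B (nU P u) ^ 3) := by simp [b3Fn, nU, Params.B]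
/-- Value of `b6Fn`. [folklore] -/
@[simp] theorem b6Fn_hdr : b6Fn P (boolPair u (ones (P.nOf u.length))) = ones (P.B (nU P u) ^ 6) := by simp [b6Fn, nU, Params.B]
/-- Value of `dFn`. [folklore] -/
@[simp] theorem dFn_hdr : dFn P (boolPair u (ones (P.nOf u.length))) = ones (dU P u) := by
  simp [dFn, dU, onesFn, unaryEncodeNat_eq_ones, nU]
/-- Value of `badFn`. [folklore] -/
@[simp] theorem badFn_hdr : badFn P (boolPair u (ones (P.nOf u.length))) = [decide (P.B (nU P u) ^ 3 ≤ dU P u)] := by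
  simp [badFn, lenLeFn_boolPair]
/-- Value of `sigFn`. [folklore] -/
@[simp] theorem sigFn_hdr : sigFn P (boolPair u (ones (P.nOf u.length))) = ones (sigU P u) := by
  simp [sigFn, sigU, modLenFn_boolPair]
/-- Value of `lamFn`. [folklore] -/
@[simp] theorem lamFn_hdr : lamFn P (boolPair u (ones (P.nOf u.length))) = ones (lamU P u) := by
  simp [lamFn, lamU, modLenFn_boolPair, divModFn_boolPair]
/-- Value of `rhoFn`. [folklore] -/
@[simp] theorem rhoFn_hdr : rhoFn P (boolPair u (ones (P.nOf u.length))) = ones (rhoU P u) := by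
  simp [rhoFn, rhoU, divModFn_boolPair]
/-- Value of `bitFn`. [folklore] -/
@[simp] theorem bitFn_hdr : bitFn (boolPair u (ones (P.nOf u.length))) = [u.headD false] := by
  simp only [bitFn, Function.comp_apply, fanoutFn_apply, fstF_boolPair, takeFn_boolPair, List.length_replicate,
    eqPairFn_boolPair]
  cases u with
  | nil => rfl
  | cons b u => cases b <;> rfl
/-- Value of `seedFn`. [folklore] -/
@[simp] theorem seedFn_hdr : seedFn P (boolPair u (ones (P.nOf u.length))) = seedU P u := by
  simp [seedFn, seedU]
/-- Value of `restFn`. [folklore] -/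
@[simp] theorem restFn_hdr : restFn P (boolPair u (ones (P.nOf u.length))) = u.drop (1 + sigU P u) := by
  simp [restFn, Nat.add_comm]
/-- Value of `kFn`. [folklore] -/
@[simp] theorem kFn_hdr : kFn P (boolPair u (ones (P.nOf u.length))) = keyU P u := by
  simp [kFn, keyU, nU]
/-- Value of `klenFn`. [folklore] -/
@[simp] theorem klenFn_hdr : klenFn P (boolPair u (ones (P.nOf u.length))) = [decide ((keyU P u).length = lamU P u)] := by
  simp only [klenFn, Function.comp_apply, fanoutFn_apply, kFn_hdr, lamFn_hdr, eqPairFn_boolPair, onesFn, unaryEncodeNat_eq_ones]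
  congr 1
  exact Bool.decide_congr ⟨fun h => by simpa using congrArg List.length h, fun h => by rw [h]⟩
/-- Value of `lFn`. [folklore] -/
@[simp] theorem lFn_hdr : lFn P (boolPair u (ones (P.nOf u.length))) = ones (P.L (nU P u)) := by simp [lFn, nU, Params.L]
/-- Value of `tFn`. [folklore] -/
@[simp] theorem tFn_hdr : tFn P (boolPair u (ones (P.nOf u.length))) = ones (P.T (nU P u)) := by simp [tFn, nU, Params.T, Params.L]

end OnHeader

/-- `FP` membership of the header bricks. [folklore] -/
theorem hdrBricks_mem_FP (hG : P.S.keyGen.IsPolyTime unaryEncodeNat (id : List Bool → List Bool)) :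
    bFn P ∈ FP ∧ b2Fn P ∈ FP ∧ b3Fn P ∈ FP ∧ b6Fn P ∈ FP ∧ dFn P ∈ FP ∧ badFn P ∈ FP ∧ sigFn P ∈ FP ∧ lamFn P ∈ FP ∧
      rhoFn P ∈ FP ∧ bitFn ∈ FP ∧ seedFn P ∈ FP ∧ restFn P ∈ FP ∧ kFn P ∈ FP ∧ klenFn P ∈ FP ∧ lFn P ∈ FP ∧ tFn P ∈ FP := by
  have hb : bFn P ∈ FP := comp_mem_FP (polyFn_mem_FP _) sndF_mem_FP
  have hb2 : b2Fn P ∈ FP := comp_mem_FP (polyFn_mem_FP _) sndF_mem_FP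
  have hb3 : b3Fn P ∈ FP := comp_mem_FP (polyFn_mem_FP _) sndF_mem_FP
  have hb6 : b6Fn P ∈ FP := comp_mem_FP (polyFn_mem_FP _) sndF_mem_FP
  have hd : dFn P ∈ FP := comp_mem_FP onesFn_mem_FP (comp_mem_FP dropFn_mem_FP (fanoutFn_mem_FP hb6 fstF_mem_FP))
  have hbad : badFn P ∈ FP := comp_mem_FP (lenLeFn_mem_FP _) (fanoutFn_mem_FP hd hb3)
  have hsig : sigFn P ∈ FP := comp_mem_FP modLenFn_mem_FP (fanoutFn_mem_FP hb hd)
  have hlam : lamFn P ∈ FP := comp_mem_FP modLenFn_mem_FP (fanoutFn_mem_FP hb (comp_mem_FP fstF_mem_FP (comp_mem_FP divModFn_mem_FP (fanoutFn_mem_FP hb hd))))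
  have hrho : rhoFn P ∈ FP := comp_mem_FP fstF_mem_FP (comp_mem_FP divModFn_mem_FP (fanoutFn_mem_FP hb2 hd))
  have hbit : bitFn ∈ FP := comp_mem_FP eqPairFn_mem_FP (fanoutFn_mem_FP (comp_mem_FP takeFn_mem_FP (fanoutFn_mem_FP (const_mem_FP _) fstF_mem_FP)) (const_mem_FP _))
  have hseed : seedFn P ∈ FP := comp_mem_FP takeFn_mem_FP (fanoutFn_mem_FP hsig (comp_mem_FP dropFn_mem_FP (fanoutFn_mem_FP (const_mem_FP _) fstF_mem_FP)))
  have hrest : restFn P ∈ FP := comp_mem_FP dropFn_mem_FP (fanoutFn_mem_FP (comp_mem_FP (cons_mem_FP true) hsig) fstF_mem_FP)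
  have hk : kFn P ∈ FP := comp_mem_FP (keyFn_mem_FP hG) (fanoutFn_mem_FP sndF_mem_FP hseed)
  have hklen : klenFn P ∈ FP := comp_mem_FP eqPairFn_mem_FP (fanoutFn_mem_FP (comp_mem_FP onesFn_mem_FP hk) hlam)
  have hl : lFn P ∈ FP := comp_mem_FP (polyFn_mem_FP _) sndF_mem_FP
  have ht : tFn P ∈ FP := comp_mem_FP (polyFn_mem_FP _) sndF_mem_FP
  exact ⟨hb, hb2, hb3, hb6, hd, hbad, hsig, hlam, hrho, hbit, hseed, hrest, hk, hklen, hl, ht⟩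

/-! ### The encryption loop -/

/-- The state of the encryption loop: budget, key, coins per component, message length, world bit,
fuel, component index, unread coins, accumulated frames. [folklore] -/
def eState (LBv : ℕ) (k : List Bool) (ρ L : ℕ) (bb : Bool) (fuel t : ℕ) (rest acc : List Bool) : List Bool :=
  boolPair (ones LBv) (boolPair k (boolPair (ones ρ) (boolPair (ones L) (boolPair [bb]
    (boolPair (ones fuel) (boolPair (ones t) (boolPair rest acc)))))))

/-- The bit `[t + 1 ≤ L]`. [folklore] -/
def tcondFn : List Bool → List Bool := lenLeFn X ∘ fanoutFn (nthF 3) (List.cons true ∘ nthF 6)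

/-- `1^{ownIdx b L t}`. [folklore] -/
def iFn : List Bool → List Bool :=
  iteFn (nthF 4) (iteFn tcondFn (nthF 6) (fun _ => [])) (iteFn tcondFn (fun _ => []) (dropFn ∘ fanoutFn (nthF 3) (nthF 6)))

/-- The `t`-th plaintext `msg L (ownIdx b L t)`. [folklore] -/
def mFn : List Bool → List Bool := takeFn ∘ fanoutFn (nthF 3) (concatFn ∘ fanoutFn (List.cons true ∘ iFn) (Kannan.zerosFn ∘ nthF 3))

/-- The `t`-th ciphertext `E(k, m; rest ↾ ρ)`. [folklore] -/
def cFn : List Bool → List Bool := encFn P.S ∘ fanoutFn (nthF 1) (fanoutFn mFn (takeFn ∘ fanoutFn (nthF 2) (nthF 7)))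

/-- The new frame `⟨c, ε⟩`, cut to `3 LB + 10`. [folklore] -/
def newFn : List Bool → List Bool := takeFn ∘ fanoutFn (polyFn (3 * X + 10) ∘ fstF) (fanoutFn (cFn P) (fun _ => []))

/-- The work of one round (everything after the budget). [folklore] -/
def workFn : List Bool → List Bool :=
  fanoutFn (nthF 1) (fanoutFn (nthF 2) (fanoutFn (nthF 3) (fanoutFn (nthF 4)
    (fanoutFn (dropFn ∘ fanoutFn (fun _ => [true]) (nthF 5))
      (fanoutFn (List.cons true ∘ nthF 6)
        (fanoutFn (dropFn ∘ fanoutFn (nthF 2) (nthF 7))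
          (concatFn ∘ fanoutFn (sndPow 7) (newFn P))))))))

/-- **One round of the encryption loop**: identity once the fuel is exhausted. [folklore] -/
def roundFn : List Bool → List Bool := fanoutFn fstF (iteFn (lenLeFn 0 ∘ fanoutFn fstF (nthF 5)) sndF (workFn P))

variable {P}

/-- The round keeps the budget. [folklore] -/
theorem roundFn_fst (w : List Bool) : (boolUnpair (roundFn P w)).1 = (boolUnpair w).1 := by simp [roundFn, fstF]

/-- **Linear growth of the round on every word.** [folklore] -/
theorem length_roundFn_le (w : List Bool) : (roundFn P w).length ≤ w.length + 28 * ((boolUnpair w).1.length + 1) := by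
  have h1 := length_boolUnpair_parts_le w
  have h2 := length_boolUnpair_parts_le (boolUnpair w).2
  have h3 := length_boolUnpair_parts_le (boolUnpair (boolUnpair w).2).2
  have h4 := length_boolUnpair_parts_le (boolUnpair (boolUnpair (boolUnpair w).2).2).2
  have h5 := length_boolUnpair_parts_le (boolUnpair (boolUnpair (boolUnpair (boolUnpair w).2).2).2).2
  have h6 := length_boolUnpair_parts_le (boolUnpair (boolUnpair (boolUnpair (boolUnpair (boolUnpair w).2).2).2).2).2
  have h7 := length_boolUnpair_parts_le (boolUnpair (boolUnpair (boolUnpair (boolUnpair (boolUnpair (boolUnpair w).2).2).2).2).2).2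
  have h8 := length_boolUnpair_parts_le (boolUnpair (boolUnpair (boolUnpair (boolUnpair (boolUnpair (boolUnpair (boolUnpair w).2).2).2).2).2).2).2
  have hnew : (newFn P w).length ≤ 3 * (boolUnpair w).1.length + 10 := by
    simp only [newFn, Function.comp_apply, fanoutFn_apply, takeFn_boolPair, polyFn_apply, List.length_take,
      List.length_replicate, eval_add, eval_mul, eval_ofNat, eval_X, fstF]
    exact min_le_left _ _
  unfold roundFn
  rcases lenLeFn_eq_or 0 (fanoutFn fstF (nthF 5) w) with h | h
  · rw [fanoutFn_apply, iteFn_apply_true (by simpa using h)]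
    simp only [length_boolPair, fstF, sndF]; omega
  · rw [fanoutFn_apply, iteFn_apply_false (by simpa using h)]
    have hw : (workFn P w).length ≤ (boolUnpair w).2.length + 26 + 3 * (boolUnpair w).1.length := by
      simp only [workFn, fanoutFn_apply, length_boolPair, Function.comp_apply, concatFn_boolPair, List.length_append,
        dropFn_boolPair, List.length_drop, List.length_cons, List.length_nil, nthF, sndPow, fstF, sndF] at hnew ⊢
      omega
    simp only [length_boolPair, fstF]; omega

variable (P)

/-- `roundFn ∈ FP` for an efficient scheme. [folklore] -/
theorem roundFn_mem_FP (hE : P.S.enc.IsPolyTime pairCode (id : List Bool → List Bool)) : roundFn P ∈ FP := by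
  have htc : tcondFn ∈ FP := comp_mem_FP (lenLeFn_mem_FP _) (fanoutFn_mem_FP (nthF_mem_FP 3) (comp_mem_FP (cons_mem_FP true) (nthF_mem_FP 6)))
  have hi : iFn ∈ FP := iteFn_mem_FP (nthF_mem_FP 4) (iteFn_mem_FP htc (nthF_mem_FP 6) (const_mem_FP []))
    (iteFn_mem_FP htc (const_mem_FP []) (comp_mem_FP dropFn_mem_FP (fanoutFn_mem_FP (nthF_mem_FP 3) (nthF_mem_FP 6))))
  have hm : mFn ∈ FP := comp_mem_FP takeFn_mem_FP (fanoutFn_mem_FP (nthF_mem_FP 3)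
    (comp_mem_FP concatFn_mem_FP (fanoutFn_mem_FP (comp_mem_FP (cons_mem_FP true) hi) (comp_mem_FP Kannan.zerosFn_mem_FP (nthF_mem_FP 3)))))
  have hc : cFn P ∈ FP := comp_mem_FP (encFn_mem_FP hE) (fanoutFn_mem_FP (nthF_mem_FP 1) (fanoutFn_mem_FP hm
    (comp_mem_FP takeFn_mem_FP (fanoutFn_mem_FP (nthF_mem_FP 2) (nthF_mem_FP 7)))))
  have hnew : newFn P ∈ FP := comp_mem_FP takeFn_mem_FP (fanoutFn_mem_FP (comp_mem_FP (polyFn_mem_FP _) fstF_mem_FP) (fanoutFn_mem_FP hc (const_mem_FP [])))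
  have hwork : workFn P ∈ FP :=
    fanoutFn_mem_FP (nthF_mem_FP 1) (fanoutFn_mem_FP (nthF_mem_FP 2) (fanoutFn_mem_FP (nthF_mem_FP 3) (fanoutFn_mem_FP (nthF_mem_FP 4)
      (fanoutFn_mem_FP (comp_mem_FP dropFn_mem_FP (fanoutFn_mem_FP (const_mem_FP [true]) (nthF_mem_FP 5)))
        (fanoutFn_mem_FP (comp_mem_FP (cons_mem_FP true) (nthF_mem_FP 6))
          (fanoutFn_mem_FP (comp_mem_FP dropFn_mem_FP (fanoutFn_mem_FP (nthF_mem_FP 2) (nthF_mem_FP 7)))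
            (comp_mem_FP concatFn_mem_FP (fanoutFn_mem_FP (sndPow_mem_FP 7) hnew))))))))
  exact fanoutFn_mem_FP fstF_mem_FP (iteFn_mem_FP (comp_mem_FP (lenLeFn_mem_FP 0) (fanoutFn_mem_FP fstF_mem_FP (nthF_mem_FP 5))) sndF_mem_FP hwork)

/-! ### Semantics of the loop -/

/-- `true :: 1ⁱ = 1^{i+1}`. [folklore] -/
theorem true_cons_ones (i : ℕ) : true :: ones i = ones (i + 1) := by simp [List.replicate_succ]

section Sem

variable {P} (LBv : ℕ) (k : List Bool) (ρ L : ℕ) (bb : Bool)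

/-- Reading the fields of a state. [folklore] -/
theorem eState_fields (fuel t : ℕ) (rest acc : List Bool) :
    fstF (eState LBv k ρ L bb fuel t rest acc) = ones LBv ∧ nthF 1 (eState LBv k ρ L bb fuel t rest acc) = k ∧
      nthF 2 (eState LBv k ρ L bb fuel t rest acc) = ones ρ ∧ nthF 3 (eState LBv k ρ L bb fuel t rest acc) = ones L ∧
      nthF 4 (eState LBv k ρ L bb fuel t rest acc) = [bb] ∧ nthF 5 (eState LBv k ρ L bb fuel t rest acc) = ones fuel ∧
      nthF 6 (eState LBv k ρ L bb fuel t rest acc) = ones t ∧ nthF 7 (eState LBv k ρ L bb fuel t rest acc) = rest ∧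
      sndPow 7 (eState LBv k ρ L bb fuel t rest acc) = acc := by
  simp [eState]

/-- Value of `iFn` on a state. [folklore] -/
theorem iFn_eState (fuel t : ℕ) (rest acc : List Bool) :
    iFn (eState LBv k ρ L bb fuel t rest acc) = ones (Params.ownIdx bb L t) := by
  obtain ⟨-, -, -, h3, h4, -, h6, -, -⟩ := eState_fields LBv k ρ L bb fuel t rest acc
  have htc : tcondFn (eState LBv k ρ L bb fuel t rest acc) = [decide (t + 1 ≤ L)] := by
    simp only [tcondFn, Function.comp_apply, fanoutFn_apply, h3, h6, lenLeFn_boolPair]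
    simp
  unfold iFn Params.ownIdx
  cases bb
  · rw [iteFn_apply_false h4]
    by_cases ht : t < L
    · rw [iteFn_apply_true (by rw [htc, decide_eq_true (by omega)]), if_neg (by simp), if_pos ht]; rfl
    · rw [iteFn_apply_false (by rw [htc, decide_eq_false (by omega)]), if_neg (by simp), if_neg ht]
      simp [h3, h6]
  · rw [iteFn_apply_true h4]
    by_cases ht : t < L
    · rw [iteFn_apply_true (by rw [htc, decide_eq_true (by omega)]), if_pos rfl, if_pos ht, h6]
    · rw [iteFn_apply_false (by rw [htc, decide_eq_false (by omega)]), if_pos rfl, if_neg ht]; rfl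

/-- Value of `mFn` on a state: the `t`-th plaintext of `M_b`. [folklore] -/
theorem mFn_eState (fuel t : ℕ) (rest acc : List Bool) :
    mFn (eState LBv k ρ L bb fuel t rest acc) = msg L (Params.ownIdx bb L t) := by
  obtain ⟨-, -, -, h3, -, -, -, -, -⟩ := eState_fields LBv k ρ L bb fuel t rest acc
  simp only [mFn, Function.comp_apply, fanoutFn_apply, h3, iFn_eState, takeFn_boolPair, concatFn_boolPair, Kannan.zerosFn_apply,
    List.length_replicate, msg, true_cons_ones]

/-- A round with exhausted fuel is the identity. [folklore] -/
theorem roundFn_eState_zero (t : ℕ) (rest acc : List Bool) :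
    roundFn P (eState LBv k ρ L bb 0 t rest acc) = eState LBv k ρ L bb 0 t rest acc := by
  unfold roundFn
  rw [fanoutFn_apply, iteFn_apply_true]
  · simp [eState, fstF, sndF]
  · simp [eState, lenLeFn_boolPair, fstF]

/-- **A round with fuel encrypts one component** (when no truncation occurs). [folklore] -/
theorem roundFn_eState_succ (fuel t : ℕ) (rest acc : List Bool)
    (hc : (P.S.enc.run (k, msg L (Params.ownIdx bb L t)) (rest.take ρ)).length ≤ LBv) :
    roundFn P (eState LBv k ρ L bb (fuel + 1) t rest acc) =
      eState LBv k ρ L bb fuel (t + 1) (rest.drop ρ) (acc ++ boolPair (P.S.enc.run (k, msg L (Params.ownIdx bb L t)) (rest.take ρ)) []) := by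
  obtain ⟨h0, h1, h2, h3, h4, h5, h6, h7, h8⟩ := eState_fields LBv k ρ L bb (fuel + 1) t rest acc
  have hcv : cFn P (eState LBv k ρ L bb (fuel + 1) t rest acc) = P.S.enc.run (k, msg L (Params.ownIdx bb L t)) (rest.take ρ) := by
    simp only [cFn, Function.comp_apply, fanoutFn_apply, h1, h2, h7, mFn_eState, takeFn_boolPair, List.length_replicate, encFn_boolPair]
  have hnew : newFn P (eState LBv k ρ L bb (fuel + 1) t rest acc) = boolPair (P.S.enc.run (k, msg L (Params.ownIdx bb L t)) (rest.take ρ)) [] := by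
    simp only [newFn, Function.comp_apply, fanoutFn_apply, h0, hcv, takeFn_boolPair, polyFn_apply, List.length_replicate, eval_add,
      eval_mul, eval_ofNat, eval_X]
    apply List.take_of_length_le
    rw [length_boolPair, List.length_nil]
    omega
  unfold roundFn
  rw [fanoutFn_apply, iteFn_apply_false]
  · unfold workFn
    simp only [fanoutFn_apply, Function.comp_apply, hnew, h0, h1, h2, h3, h4, h5, h6, h7, h8, dropFn_boolPair, List.length_singleton,
      List.length_replicate, concatFn_boolPair]
    simp [eState, true_cons_ones, ones]
  · simp [eState, lenLeFn_boolPair, fstF, ones]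

/-- `encVec` grows by one component. [folklore] -/
theorem encVec_append_singleton (S : SKEScheme) (k : List Bool) (ρ : ℕ) : ∀ (ms : List (List Bool)) (m : List Bool) (r : List Bool),
    S.encVec k ρ (ms ++ [m]) r = S.encVec k ρ ms r ++ [S.enc.run (k, m) ((r.drop (ms.length * ρ)).take ρ)]
  | [], m, r => by simp
  | m' :: ms, m, r => by
    rw [List.cons_append, SKEScheme.encVec_cons, SKEScheme.encVec_cons, encVec_append_singleton S k ρ ms m (r.drop ρ), List.drop_drop,
      List.length_cons, Nat.succ_mul, Nat.add_comm]
    rfl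

/-- The first `j` plaintexts of `M_b(n)` (through `L`). [folklore] -/
def msgsUpTo (L : ℕ) (bb : Bool) (j : ℕ) : List (List Bool) := (List.range j).map fun t => msg L (Params.ownIdx bb L t)

omit LBv k ρ in
/-- One more plaintext. [folklore] -/
theorem msgsUpTo_succ (j : ℕ) : msgsUpTo L bb (j + 1) = msgsUpTo L bb j ++ [msg L (Params.ownIdx bb L j)] := by
  simp [msgsUpTo, List.range_succ]

omit LBv k ρ in
/-- `msgsUpTo` has `j` plaintexts. [folklore] -/
@[simp] theorem length_msgsUpTo (j : ℕ) : (msgsUpTo L bb j).length = j := by simp [msgsUpTo]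

/-- **Rounds of the loop** from the initial state: after `j ≤ T` rounds, `j` components are
encrypted. [folklore] -/
theorem iterate_roundFn {T : ℕ} {r : List Bool}
    (hc : ∀ (t : ℕ) (r' : List Bool), r'.length ≤ ρ → (P.S.enc.run (k, msg L (Params.ownIdx bb L t)) r').length ≤ LBv) :
    ∀ j, j ≤ T → (roundFn P)^[j] (eState LBv k ρ L bb T 0 r []) =
      eState LBv k ρ L bb (T - j) j (r.drop (j * ρ)) (frames (P.S.encVec k ρ (msgsUpTo L bb j) r))
  | 0, _ => by simp [msgsUpTo]
  | j + 1, hj => by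
    rw [Function.iterate_succ_apply', iterate_roundFn hc j (by omega), show T - j = (T - (j + 1)) + 1 by omega,
      roundFn_eState_succ _ _ _ _ _ _ _ _ _ (hc _ _ (by simp)), List.drop_drop, msgsUpTo_succ, encVec_append_singleton,
      frames_append, frames_cons_eq_boolPair, frames_nil, length_msgsUpTo, Nat.succ_mul]

omit bb in
/-- Rounds beyond the fuel change nothing. [folklore] -/
theorem iterate_roundFn_of_zero (bb : Bool) (t : ℕ) (rest acc : List Bool) :
    ∀ j, (roundFn P)^[j] (eState LBv k ρ L bb 0 t rest acc) = eState LBv k ρ L bb 0 t rest acc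
  | 0 => rfl
  | j + 1 => by rw [Function.iterate_succ_apply', iterate_roundFn_of_zero bb t rest acc j, roundFn_eState_zero]

end Sem

/-! ### The whole pipeline -/

/-- The initial state of the loop, from the header `⟨u, 1ⁿ⟩`. [folklore] -/
def initFn (LB : Polynomial ℕ) : List Bool → List Bool :=
  fanoutFn (polyFn LB ∘ fstF) (fanoutFn (kFn P) (fanoutFn (rhoFn P) (fanoutFn (lFn P) (fanoutFn bitFn
    (fanoutFn (tFn P) (fanoutFn (fun _ => []) (fanoutFn (restFn P) (fun _ => []))))))))

/-- The accumulated frames `frames (Ē_k(M_b(n); rest))` after the loop. [folklore] -/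
def accFn (LB : Polynomial ℕ) : List Bool → List Bool :=
  sndPow 7 ∘ (fun z => (roundFn P)^[X.eval (boolUnpair z).1.length] z) ∘ initFn P LB ∘ hdrFn P

/-- The real output `⟨1^{|u|}, ⟨1^T, frames⟩⟩`. [folklore] -/
def realFn (LB : Polynomial ℕ) : List Bool → List Bool := fanoutFn onesFn (fanoutFn (tFn P ∘ hdrFn P) (accFn P LB))

/-- **The block function as a pipeline.** [folklore] -/
def blockFnP (LB : Polynomial ℕ) : List Bool → List Bool :=
  iteFn (badFn P ∘ hdrFn P) (fun _ => []) (iteFn (klenFn P ∘ hdrFn P) (realFn P LB) (fun _ => []))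

/-- `blockFnP ∈ FP` for an efficient scheme. [folklore] -/
theorem blockFnP_mem_FP (hG : P.S.keyGen.IsPolyTime unaryEncodeNat (id : List Bool → List Bool))
    (hE : P.S.enc.IsPolyTime pairCode (id : List Bool → List Bool)) (LB : Polynomial ℕ) : blockFnP P LB ∈ FP := by
  obtain ⟨-, -, -, -, -, hbad, -, -, hrho, hbit, -, hrest, hk, hklen, -, ht⟩ := hdrBricks_mem_FP P hG
  have hhdr := hdrFn_mem_FP P
  have hinit : initFn P LB ∈ FP :=
    fanoutFn_mem_FP (comp_mem_FP (polyFn_mem_FP LB) fstF_mem_FP) (fanoutFn_mem_FP hk (fanoutFn_mem_FP hrho (fanoutFn_mem_FP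
      (comp_mem_FP (polyFn_mem_FP _) sndF_mem_FP) (fanoutFn_mem_FP hbit (fanoutFn_mem_FP ht (fanoutFn_mem_FP (const_mem_FP [])
        (fanoutFn_mem_FP hrest (const_mem_FP []))))))))
  have hacc : accFn P LB ∈ FP :=
    comp_mem_FP (sndPow_mem_FP 7) (comp_mem_FP (iterate_mem_FP_of_growth (roundFn_mem_FP P hE) 28 roundFn_fst
      length_roundFn_le X) (comp_mem_FP hinit hhdr))
  have hreal : realFn P LB ∈ FP := fanoutFn_mem_FP onesFn_mem_FP (fanoutFn_mem_FP (comp_mem_FP ht hhdr) hacc)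
  exact iteFn_mem_FP (comp_mem_FP hbad hhdr) (const_mem_FP []) (iteFn_mem_FP (comp_mem_FP hklen hhdr) hreal (const_mem_FP []))

/-- The initial state. [folklore] -/
theorem initFn_hdr (LB : Polynomial ℕ) (u : List Bool) :
    initFn P LB (boolPair u (ones (P.nOf u.length))) =
      eState (LB.eval u.length) (keyU P u) (rhoU P u) (P.L (nU P u)) (u.headD false) (P.T (nU P u)) 0 (u.drop (1 + sigU P u)) [] := by
  simp [initFn, eState, ones]

/-- **The loop computes the frames of the ciphertext vector** (under the length budget). [folklore] -/
theorem accFn_apply {LB : Polynomial ℕ} {u : List Bool} (hT : P.T (nU P u) ≤ LB.eval u.length)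
    (hc : ∀ (t : ℕ) (r' : List Bool), r'.length ≤ rhoU P u →
      (P.S.enc.run (keyU P u, msg (P.L (nU P u)) (Params.ownIdx (u.headD false) (P.L (nU P u)) t)) r').length ≤ LB.eval u.length) :
    accFn P LB u = frames (P.S.encVec (keyU P u) (rhoU P u) (P.msgs (u.headD false) (nU P u)) (u.drop (1 + sigU P u))) := by
  have hsplit : (roundFn P)^[LB.eval u.length] = (roundFn P)^[LB.eval u.length - P.T (nU P u)] ∘ (roundFn P)^[P.T (nU P u)] := by
    rw [← Function.iterate_add, Nat.sub_add_cancel hT]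
  simp only [accFn, Function.comp_apply, hdrFn_apply, initFn_hdr]
  rw [show (boolUnpair (eState (LB.eval u.length) (keyU P u) (rhoU P u) (P.L (nU P u)) (u.headD false) (P.T (nU P u)) 0
      (u.drop (1 + sigU P u)) [])).1.length = LB.eval u.length by simp [eState], eval_X, hsplit, Function.comp_apply,
    iterate_roundFn _ _ _ _ _ hc (P.T (nU P u)) le_rfl, Nat.sub_self, iterate_roundFn_of_zero]
  obtain ⟨-, -, -, -, -, -, -, -, h8⟩ := eState_fields (LB.eval u.length) (keyU P u) (rhoU P u) (P.L (nU P u)) (u.headD false) 0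
    (P.T (nU P u)) ((u.drop (1 + sigU P u)).drop (P.T (nU P u) * rhoU P u))
    (frames (P.S.encVec (keyU P u) (rhoU P u) (msgsUpTo (P.L (nU P u)) (u.headD false) (P.T (nU P u))) (u.drop (1 + sigU P u))))
  rw [h8]
  rfl

/-- **The pipeline computes the block function**, provided the budget polynomial dominates `T`
and the ciphertext lengths on genuine inputs. [folklore] -/
theorem blockFnP_apply {LB : Polynomial ℕ} {u : List Bool} (hT : P.T (nU P u) ≤ LB.eval u.length)
    (hc : ∀ (t : ℕ) (r' : List Bool), r'.length ≤ rhoU P u →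
      (P.S.enc.run (keyU P u, msg (P.L (nU P u)) (Params.ownIdx (u.headD false) (P.L (nU P u)) t)) r').length ≤ LB.eval u.length) :
    blockFnP P LB u = P.blockFn u := by
  unfold blockFnP Params.blockFn
  by_cases hbad : P.B (P.nOf u.length) ^ 3 ≤ u.length - P.B (P.nOf u.length) ^ 6
  · rw [iteFn_apply_true (by
      rw [Function.comp_apply, hdrFn_apply, badFn_hdr]
      simp only [List.cons.injEq, and_true, decide_eq_true_eq]
      exact hbad), if_pos hbad]
  · rw [iteFn_apply_false (by
      rw [Function.comp_apply, hdrFn_apply, badFn_hdr]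
      simp only [List.cons.injEq, and_true, decide_eq_false_iff_not]
      exact hbad), if_neg hbad]
    by_cases hk : (P.S.keyGen.run (P.nOf u.length) ((u.drop 1).take ((u.length - P.B (P.nOf u.length) ^ 6) % P.B (P.nOf u.length)))).length =
        (u.length - P.B (P.nOf u.length) ^ 6) / P.B (P.nOf u.length) % P.B (P.nOf u.length)
    · rw [iteFn_apply_true (by
        rw [Function.comp_apply, hdrFn_apply, klenFn_hdr]
        simp only [List.cons.injEq, and_true, decide_eq_true_eq]
        exact hk), if_pos hk]
      simp only [realFn, fanoutFn_apply, Function.comp_apply, hdrFn_apply, tFn_hdr, accFn_apply P hT hc, onesFn, unaryEncodeNat_eq_ones]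
      have hmap : ∀ l : List (List Bool), List.map (encodingList Bool).encode l = l := fun l => List.map_id _
      congr 1
      rw [Complexity.listBool_encode_eq, ← boolPair_eq, unaryEncodeNat_eq_ones, hmap, SKEScheme.length_encVec, P.length_msgs]
      rfl
    · rw [iteFn_apply_false (by
        rw [Function.comp_apply, hdrFn_apply, klenFn_hdr]
        simp only [List.cons.injEq, and_true, decide_eq_false_iff_not]
        exact hk), if_neg hk]

end BProg

/-! ### The block function is polynomial-time -/

/-- **`blockFn ∈ FP`** for an efficient scheme whose key-generation coins obey `pG`: choose the
budget polynomial from the output-length polynomials of the two machines. [Goldreich 2004, §5.5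
Exercise 2 ("polynomial-time constructible")] [folklore] -/
theorem blockFn_mem_FP (P : Params) (hG : P.S.keyGen.IsPolyTime unaryEncodeNat (id : List Bool → List Bool))
    (hE : P.S.enc.IsPolyTime pairCode (id : List Bool → List Bool)) : P.blockFn ∈ FP := by
  obtain ⟨pKo, hpKo⟩ := exists_poly_length_le_of_polyTime hG.1
  obtain ⟨pCo, hpCo⟩ := exists_poly_length_le_of_polyTime hE.1
  -- all lengths at a genuine input `u` are polynomial in `|u|`: `n ≤ |u|`, `B(n) ≤ B(|u|)`, `|s| ≤ B`, `ρ̂ ≤ |u|`, `L(n) ≤ B(|u|)`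
  set KB : Polynomial ℕ := pKo.comp (2 * X + 2 + P.Bpoly) with hKB
  set LB : Polynomial ℕ := 2 * P.Bpoly + pCo.comp (2 * (2 * KB + 2 + P.Bpoly) + 2 + X) with hLB
  have hfun : P.blockFn = BProg.blockFnP P LB := by
    funext u
    have hn : BProg.nU P u ≤ u.length := Nat.findGreatest_le _
    have hB : P.B (BProg.nU P u) ≤ P.B u.length := P.B_mono hn
    have hBpos : 0 < P.B (BProg.nU P u) := by have := P.le_B (BProg.nU P u); omega
    have hL : P.L (BProg.nU P u) ≤ P.B u.length := by have := P.B_eq (BProg.nU P u); omega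
    have hsig : BProg.sigU P u ≤ P.B u.length := (Nat.mod_lt _ hBpos).le.trans hB
    have hrho : BProg.rhoU P u ≤ u.length := by
      unfold BProg.rhoU BProg.dU
      exact (Nat.div_le_self _ _).trans (Nat.sub_le _ _)
    have hkey : (BProg.keyU P u).length ≤ KB.eval u.length := by
      unfold BProg.keyU
      have h := hpKo (BProg.nU P u, BProg.seedU P u)
      simp only [id, length_boolPair, SKEScheme.length_unaryEncodeNat] at h
      refine h.trans ?_
      rw [hKB]
      simp only [eval_comp, eval_add, eval_mul, eval_ofNat, eval_X]
      refine natPoly_eval_mono _ ?_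
      have : (BProg.seedU P u).length ≤ BProg.sigU P u := by unfold BProg.seedU; simp
      change 2 * BProg.nU P u + 2 + (BProg.seedU P u).length ≤ 2 * u.length + 2 + P.Bpoly.eval u.length
      have := P.B_eq u.length; unfold Params.B at hsig hB; omega
    refine (BProg.blockFnP_apply P ?_ ?_).symm
    · rw [hLB]; simp only [eval_add, eval_mul, eval_ofNat]; unfold Params.T; unfold Params.B at hL; omega
    · intro t r' hr'
      have h := hpCo ((BProg.keyU P u, msg (P.L (BProg.nU P u)) (Params.ownIdx (u.headD false) (P.L (BProg.nU P u)) t)), r')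
      simp only [id, length_boolPair, pairCode, Function.uncurry, length_msg] at h
      refine h.trans ?_
      rw [hLB]
      simp only [eval_add, eval_mul, eval_ofNat, eval_comp, eval_X]
      refine le_add_left ((natPoly_eval_mono _ ?_))
      unfold Params.B at hL
      omega
  rw [hfun]
  exact BProg.blockFnP_mem_FP P hG hE LB

end

end SKEOWF

end Literature.Computability.Cryptography


/-!
# Private-key encryption ⇒ one-way functions, VIII: the candidate `F` is polynomial-time

Eighth file of the discharge of `OWFExist_of_secureSKEExist` (Impagliazzo–Luby 1989, Thm. 1); see
`SchemesOWF.lean`, Part I (architecture), `SchemesOWF.lean`, Part II (`Params.F`, `Params.Fsplice`) and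
`SchemesOWFProgram.lean`, Part VII (`blockFn ∈ FP`). Again no machine is programmed; the direct product
is a pipeline of plumbing bricks around two clocked loops:

* `FProg.mofFn z = 1^{Mof |z|}` (clocked search for the largest `m` with `m³ ≤ |z|`);
* the **splice loop** (`FProg.sRoundFn`) on the state
  `⟨1^{bud}, ⟨1^M, ⟨[fl], ⟨1^{q₀}, ⟨o, ⟨1^{fuel}, ⟨1^{cnt}, ⟨rest, acc⟩⟩⟩⟩⟩⟩⟩⟩`: while fuel lasts,
  cut the next block of length `cnt / M + 1` from `rest`, emit `o` if `fl ∧ cnt = q₀` and the block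
  function of the block otherwise, and append the frame of the emitted string (cut to the budget) to
  `acc` — so that the same loop computes the block outputs of `F` (`fl = 0`) and of the splice
  `Fsplice` used by the distinguisher (`fl = 1`); `FProg.spliceFn`, `FProg.spliceFn_apply`;
* `FProg.FFn`: `pad_{Λ(|w|)}(⟨1^M, acc⟩)`; `FProg.FFn_eq`, `F_mem_FP`.

## References

* O. Goldreich, *Foundations of Cryptography I*, CUP 2001, §2.3.1 ("Clearly, `g` can be computed in
  polynomial time"); §2.2.3 (padding).
* S. Arora, B. Barak, *Computational Complexity: A Modern Approach*, CUP 2009, §1.3, §1.4.1.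
-/

namespace Literature.Computability.Cryptography

namespace SKEOWF

open _root_.Computability Polynomial Complexity Complexity.Plumb Complexity.Brick Complexity.OracleCompose

noncomputable section

namespace FProg

/-! ### `Mof |z|` by a clocked search -/

/-- The search step: `k ↦ k + 1` while `(k+1)^3 ≤ m`. [folklore] -/
def mstep (m k : ℕ) : ℕ := if (k + 1) ^ 3 ≤ m then k + 1 else k

/-- The stop condition `[|z| + 1 ≤ (k+1)^3]` on the state `⟨z, 1ᵏ⟩`. [folklore] -/
def mofCond : List Bool → List Bool := lenLeFn ((X + 1) ^ 3) ∘ fanoutFn sndF (List.cons true ∘ fstF)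

/-- One round of the search. [folklore] -/
def mofRound : List Bool → List Bool := fanoutFn fstF (iteFn mofCond sndF (List.cons true ∘ sndF))

/-- Value of the condition. [folklore] -/
theorem mofCond_state (z : List Bool) (k : ℕ) : mofCond (boolPair z (ones k)) = [decide (z.length + 1 ≤ (k + 1) ^ 3)] := by
  simp [mofCond, lenLeFn_boolPair]

/-- Value of the round. [folklore] -/
theorem mofRound_state (z : List Bool) (k : ℕ) : mofRound (boolPair z (ones k)) = boolPair z (ones (mstep z.length k)) := by
  unfold mofRound mstep
  rw [fanoutFn_apply, fstF_boolPair]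
  by_cases h : (k + 1) ^ 3 ≤ z.length
  · rw [iteFn_apply_false (by rw [mofCond_state, decide_eq_false (by omega)]), if_pos h]
    simp [List.replicate_succ]
  · rw [iteFn_apply_true (by rw [mofCond_state, decide_eq_true (by omega)]), if_neg h]
    simp

/-- Additive growth of the round. [folklore] -/
theorem length_mofRound_le (w : List Bool) : (mofRound w).length ≤ w.length + 3 := by
  have h1 := length_boolUnpair_parts_le w
  unfold mofRound
  rcases lenLeFn_eq_or ((X + 1) ^ 3) (fanoutFn sndF (List.cons true ∘ fstF) w) with h | h
  · rw [fanoutFn_apply, iteFn_apply_true (by simpa [mofCond] using h)]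
    simp only [length_boolPair, fstF, sndF]; omega
  · rw [fanoutFn_apply, iteFn_apply_false (by simpa [mofCond] using h)]
    simp only [length_boolPair, fstF, sndF, Function.comp_apply, List.length_cons]; omega

/-- **The search computes `Mof`**: after `i ≤ m` rounds the counter is `min i (Mof m)`. [folklore] -/
theorem iterate_mstep (m : ℕ) : ∀ i, i ≤ m → (mstep m)^[i] 0 = min i (Mof m)
  | 0, _ => by simp
  | i + 1, hi => by
    rw [Function.iterate_succ_apply', iterate_mstep m i (by omega)]
    have hGm : Mof m ≤ m := Nat.findGreatest_le m
    have hG2 : ∀ n, Mof m < n → n ≤ m → ¬ n ^ 3 ≤ m := fun n h1 h2 =>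
      Nat.findGreatest_is_greatest (P := fun k => k ^ 3 ≤ m) h1 h2
    unfold mstep
    by_cases hiG : i < Mof m
    · have hG1 : Mof m ^ 3 ≤ m := Mof_pow_le m
      have hmono : (i + 1) ^ 3 ≤ Mof m ^ 3 := Nat.pow_le_pow_left (by omega) 3
      rw [min_eq_left hiG.le, if_pos (hmono.trans hG1), min_eq_left (by omega)]
    · rw [min_eq_right (by omega), if_neg (hG2 _ (by omega) (by omega)), min_eq_right (by omega)]

/-- Rounds of the search on a state. [folklore] -/
theorem iterate_mofRound (z : List Bool) : ∀ i, mofRound^[i] (boolPair z (ones 0)) = boolPair z (ones ((mstep z.length)^[i] 0))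
  | 0 => rfl
  | i + 1 => by rw [Function.iterate_succ_apply', iterate_mofRound z i, mofRound_state, Function.iterate_succ_apply']

/-- **`mofFn z = 1^{Mof |z|}`.** [folklore] -/
def mofFn : List Bool → List Bool :=
  sndF ∘ (fun z => mofRound^[X.eval (boolUnpair z).1.length] z) ∘ fanoutFn id (fun _ => [])

/-- Value of `mofFn`. [folklore] -/
@[simp] theorem mofFn_apply (z : List Bool) : mofFn z = ones (Mof z.length) := by
  have h := iterate_mofRound z z.length
  have hle : Mof z.length ≤ z.length := Nat.findGreatest_le _
  rw [iterate_mstep z.length z.length le_rfl, min_eq_right hle] at h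
  simp only [mofFn, Function.comp_apply, fanoutFn_apply, id, boolUnpair_boolPair, eval_X]
  rw [show (boolPair z [] : List Bool) = boolPair z (ones 0) from rfl, h, sndF_boolPair]

/-- `mofFn ∈ FP`. [folklore] -/
theorem mofFn_mem_FP : mofFn ∈ FP :=
  comp_mem_FP sndF_mem_FP (comp_mem_FP
    (iterate_mem_FP (fanoutFn_mem_FP fstF_mem_FP (iteFn_mem_FP
      (comp_mem_FP (lenLeFn_mem_FP _) (fanoutFn_mem_FP sndF_mem_FP (comp_mem_FP (cons_mem_FP true) fstF_mem_FP)))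
      sndF_mem_FP (comp_mem_FP (cons_mem_FP true) sndF_mem_FP))) 3 length_mofRound_le X)
    (fanoutFn_mem_FP OracleCompose.id_mem_FP (const_mem_FP [])))

/-! ### The splice loop -/

variable (P : Params)

/-- The state of the splice loop: budget, `M`, splice flag, splice index, splice value, fuel,
flat block counter, unread input, accumulated frames. [folklore] -/
def sState (bud M : ℕ) (fl : Bool) (q₀ : ℕ) (o : List Bool) (fuel cnt : ℕ) (rest acc : List Bool) : List Bool :=
  boolPair (ones bud) (boolPair (ones M) (boolPair [fl] (boolPair (ones q₀) (boolPair o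
    (boolPair (ones fuel) (boolPair (ones cnt) (boolPair rest acc)))))))

/-- The current block length `cnt / M + 1`, as `1^{·}`. [folklore] -/
def lenFn : List Bool → List Bool := List.cons true ∘ fstF ∘ divModFn ∘ fanoutFn (nthF 1) (nthF 6)

/-- The current block `rest ↾ (cnt / M + 1)`. [folklore] -/
def blkF : List Bool → List Bool := takeFn ∘ fanoutFn lenFn (nthF 7)

/-- The bit `[fl ∧ cnt = q₀]`. [folklore] -/
def splCond : List Bool → List Bool := andFn (nthF 2) (eqPairFn ∘ fanoutFn (nthF 6) (nthF 3))

/-- The emitted string: the splice value or the block function of the block. [folklore] -/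
def outF : List Bool → List Bool := iteFn splCond (nthF 4) (P.blockFn ∘ blkF)

/-- The new frame `⟨out, ε⟩`, cut to the budget. [folklore] -/
def sNewFn : List Bool → List Bool := takeFn ∘ fanoutFn fstF (fanoutFn (outF P) (fun _ => []))

/-- The work of one round. [folklore] -/
def sWorkFn : List Bool → List Bool :=
  fanoutFn (nthF 1) (fanoutFn (nthF 2) (fanoutFn (nthF 3) (fanoutFn (nthF 4)
    (fanoutFn (dropFn ∘ fanoutFn (fun _ => [true]) (nthF 5))
      (fanoutFn (List.cons true ∘ nthF 6)
        (fanoutFn (dropFn ∘ fanoutFn lenFn (nthF 7))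
          (concatFn ∘ fanoutFn (sndPow 7) (sNewFn P))))))))

/-- **One round of the splice loop.** [folklore] -/
def sRoundFn : List Bool → List Bool := fanoutFn fstF (iteFn (lenLeFn 0 ∘ fanoutFn fstF (nthF 5)) sndF (sWorkFn P))

variable {P}

/-- The round keeps the budget. [folklore] -/
theorem sRoundFn_fst (w : List Bool) : (boolUnpair (sRoundFn P w)).1 = (boolUnpair w).1 := by simp [sRoundFn, fstF]

/-- **Linear growth of the round on every word.** [folklore] -/
theorem length_sRoundFn_le (w : List Bool) : (sRoundFn P w).length ≤ w.length + 28 * ((boolUnpair w).1.length + 1) := by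
  have h1 := length_boolUnpair_parts_le w
  have h2 := length_boolUnpair_parts_le (boolUnpair w).2
  have h3 := length_boolUnpair_parts_le (boolUnpair (boolUnpair w).2).2
  have h4 := length_boolUnpair_parts_le (boolUnpair (boolUnpair (boolUnpair w).2).2).2
  have h5 := length_boolUnpair_parts_le (boolUnpair (boolUnpair (boolUnpair (boolUnpair w).2).2).2).2
  have h6 := length_boolUnpair_parts_le (boolUnpair (boolUnpair (boolUnpair (boolUnpair (boolUnpair w).2).2).2).2).2
  have h7 := length_boolUnpair_parts_le (boolUnpair (boolUnpair (boolUnpair (boolUnpair (boolUnpair (boolUnpair w).2).2).2).2).2).2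
  have h8 := length_boolUnpair_parts_le (boolUnpair (boolUnpair (boolUnpair (boolUnpair (boolUnpair (boolUnpair (boolUnpair w).2).2).2).2).2).2).2
  have hnew : (sNewFn P w).length ≤ (boolUnpair w).1.length := by
    simp only [sNewFn, Function.comp_apply, fanoutFn_apply, takeFn_boolPair, List.length_take, fstF]
    exact min_le_left _ _
  unfold sRoundFn
  rcases lenLeFn_eq_or 0 (fanoutFn fstF (nthF 5) w) with h | h
  · rw [fanoutFn_apply, iteFn_apply_true (by simpa using h)]
    simp only [length_boolPair, fstF, sndF]; omega
  · rw [fanoutFn_apply, iteFn_apply_false (by simpa using h)]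
    have hw : (sWorkFn P w).length ≤ (boolUnpair w).2.length + 16 + (boolUnpair w).1.length := by
      simp only [sWorkFn, fanoutFn_apply, length_boolPair, Function.comp_apply, concatFn_boolPair, List.length_append,
        dropFn_boolPair, List.length_drop, List.length_cons, List.length_nil, nthF, sndPow, fstF, sndF] at hnew ⊢
      omega
    simp only [length_boolPair, fstF]; omega

variable (P)

/-- `sRoundFn ∈ FP` when the block function is. [folklore] -/
theorem sRoundFn_mem_FP (hb : P.blockFn ∈ FP) : sRoundFn P ∈ FP := by
  have hlen : lenFn ∈ FP := comp_mem_FP (cons_mem_FP true) (comp_mem_FP fstF_mem_FP (comp_mem_FP divModFn_mem_FP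
    (fanoutFn_mem_FP (nthF_mem_FP 1) (nthF_mem_FP 6))))
  have hblk : blkF ∈ FP := comp_mem_FP takeFn_mem_FP (fanoutFn_mem_FP hlen (nthF_mem_FP 7))
  have hcond : splCond ∈ FP := andFn_mem_FP (nthF_mem_FP 2) (comp_mem_FP eqPairFn_mem_FP (fanoutFn_mem_FP (nthF_mem_FP 6) (nthF_mem_FP 3)))
  have hout : outF P ∈ FP := iteFn_mem_FP hcond (nthF_mem_FP 4) (comp_mem_FP hb hblk)
  have hnew : sNewFn P ∈ FP := comp_mem_FP takeFn_mem_FP (fanoutFn_mem_FP fstF_mem_FP (fanoutFn_mem_FP hout (const_mem_FP [])))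
  have hwork : sWorkFn P ∈ FP :=
    fanoutFn_mem_FP (nthF_mem_FP 1) (fanoutFn_mem_FP (nthF_mem_FP 2) (fanoutFn_mem_FP (nthF_mem_FP 3) (fanoutFn_mem_FP (nthF_mem_FP 4)
      (fanoutFn_mem_FP (comp_mem_FP dropFn_mem_FP (fanoutFn_mem_FP (const_mem_FP [true]) (nthF_mem_FP 5)))
        (fanoutFn_mem_FP (comp_mem_FP (cons_mem_FP true) (nthF_mem_FP 6))
          (fanoutFn_mem_FP (comp_mem_FP dropFn_mem_FP (fanoutFn_mem_FP hlen (nthF_mem_FP 7)))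
            (comp_mem_FP concatFn_mem_FP (fanoutFn_mem_FP (sndPow_mem_FP 7) hnew))))))))
  exact fanoutFn_mem_FP fstF_mem_FP (iteFn_mem_FP (comp_mem_FP (lenLeFn_mem_FP 0) (fanoutFn_mem_FP fstF_mem_FP (nthF_mem_FP 5))) sndF_mem_FP hwork)

/-! ### Semantics of the splice loop -/

/-- The spliced block outputs of `w` for `M` block lengths: the block function of every block of
`chop (lens M) w`, with entry `q₀` replaced by `o` when the flag is set. [folklore] -/
def outsS (M : ℕ) (fl : Bool) (q₀ : ℕ) (o : List Bool) (w : List Bool) : List (List Bool) :=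
  if fl then ((chop (lens M) w).map P.blockFn).set q₀ o else (chop (lens M) w).map P.blockFn

/-- Number of spliced outputs. [folklore] -/
@[simp] theorem length_outsS (M : ℕ) (fl : Bool) (q₀ : ℕ) (o : List Bool) (w : List Bool) : (outsS P M fl q₀ o w).length = M * M := by
  unfold outsS; split_ifs <;> simp

/-- The `t`-th spliced output. [folklore] -/
theorem outsS_getElem {M : ℕ} (fl : Bool) (q₀ : ℕ) (o : List Bool) (w : List Bool) {t : ℕ} (ht : t < M * M) :
    (outsS P M fl q₀ o w)[t]'(by simpa using ht) =
      if fl ∧ t = q₀ then o else P.blockFn ((w.drop ((lens M).take t).sum).take (t / M + 1)) := by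
  have hq : t < (chop (lens M) w).length := by simpa using ht
  have hblk : (chop (lens M) w)[t] = (w.drop ((lens M).take t).sum).take (t / M + 1) := by
    rw [chop_getElem _ _ _ hq, lens_getElem]
  by_cases h : fl ∧ t = q₀
  · obtain ⟨hfl, rfl⟩ := h
    rw [if_pos ⟨hfl, rfl⟩, List.getElem_of_eq (show outsS P M fl t o w = ((chop (lens M) w).map P.blockFn).set t o by simp [outsS, hfl]),
      List.getElem_set_self]
  · rw [if_neg h]
    cases fl
    · rw [List.getElem_of_eq (show outsS P M false q₀ o w = (chop (lens M) w).map P.blockFn by simp [outsS]), List.getElem_map, hblk]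
    · have hne : q₀ ≠ t := fun e => h ⟨rfl, e.symm⟩
      rw [List.getElem_of_eq (show outsS P M true q₀ o w = ((chop (lens M) w).map P.blockFn).set q₀ o by simp [outsS]),
        List.getElem_set_ne hne, List.getElem_map, hblk]

section Sem

variable {P} (bud M : ℕ) (fl : Bool) (q₀ : ℕ) (o : List Bool)

/-- Reading the fields of a state. [folklore] -/
theorem sState_fields (fuel cnt : ℕ) (rest acc : List Bool) :
    fstF (sState bud M fl q₀ o fuel cnt rest acc) = ones bud ∧ nthF 1 (sState bud M fl q₀ o fuel cnt rest acc) = ones M ∧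
      nthF 2 (sState bud M fl q₀ o fuel cnt rest acc) = [fl] ∧ nthF 3 (sState bud M fl q₀ o fuel cnt rest acc) = ones q₀ ∧
      nthF 4 (sState bud M fl q₀ o fuel cnt rest acc) = o ∧ nthF 5 (sState bud M fl q₀ o fuel cnt rest acc) = ones fuel ∧
      nthF 6 (sState bud M fl q₀ o fuel cnt rest acc) = ones cnt ∧ nthF 7 (sState bud M fl q₀ o fuel cnt rest acc) = rest ∧
      sndPow 7 (sState bud M fl q₀ o fuel cnt rest acc) = acc := by
  simp [sState]

/-- Value of `lenFn` on a state. [folklore] -/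
theorem lenFn_sState (fuel cnt : ℕ) (rest acc : List Bool) : lenFn (sState bud M fl q₀ o fuel cnt rest acc) = ones (cnt / M + 1) := by
  obtain ⟨-, h1, -, -, -, -, h6, -, -⟩ := sState_fields bud M fl q₀ o fuel cnt rest acc
  simp only [lenFn, Function.comp_apply, fanoutFn_apply, h1, h6, divModFn_boolPair, fstF_boolPair, BProg.true_cons_ones]

/-- Value of `outF` on a state. [folklore] -/
theorem outF_sState (fuel cnt : ℕ) (rest acc : List Bool) :
    outF P (sState bud M fl q₀ o fuel cnt rest acc) = if fl ∧ cnt = q₀ then o else P.blockFn (rest.take (cnt / M + 1)) := by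
  obtain ⟨-, -, h2, h3, h4, -, h6, h7, -⟩ := sState_fields bud M fl q₀ o fuel cnt rest acc
  have hcond : splCond (sState bud M fl q₀ o fuel cnt rest acc) = [fl && decide (cnt = q₀)] := by
    unfold splCond
    rw [andFn_apply h2]
    simp only [Function.comp_apply, fanoutFn_apply, h6, h3, eqPairFn_boolPair]
    have hdec : decide (ones cnt = ones q₀) = decide (cnt = q₀) :=
      Bool.decide_congr ⟨fun h => by simpa using congrArg List.length h, fun h => by rw [h]⟩
    rw [hdec]
  unfold outF
  by_cases h : fl ∧ cnt = q₀
  · rw [iteFn_apply_true (by rw [hcond, h.1, decide_eq_true h.2]; rfl), if_pos h, h4]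
  · rw [iteFn_apply_false (by
      rw [hcond]
      cases fl
      · rfl
      · simp only [true_and] at h; rw [decide_eq_false h]; rfl), if_neg h]
    simp only [Function.comp_apply, blkF, fanoutFn_apply, lenFn_sState, h7, takeFn_boolPair, List.length_replicate]

/-- A round with exhausted fuel is the identity. [folklore] -/
theorem sRoundFn_sState_zero (cnt : ℕ) (rest acc : List Bool) :
    sRoundFn P (sState bud M fl q₀ o 0 cnt rest acc) = sState bud M fl q₀ o 0 cnt rest acc := by
  unfold sRoundFn
  rw [fanoutFn_apply, iteFn_apply_true]
  · simp [sState, fstF, sndF]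
  · simp [sState, lenLeFn_boolPair, fstF]

/-- **A round with fuel emits one frame** (when no truncation occurs). [folklore] -/
theorem sRoundFn_sState_succ (fuel cnt : ℕ) (rest acc : List Bool)
    (hlen : (boolPair (if fl ∧ cnt = q₀ then o else P.blockFn (rest.take (cnt / M + 1))) []).length ≤ bud) :
    sRoundFn P (sState bud M fl q₀ o (fuel + 1) cnt rest acc) =
      sState bud M fl q₀ o fuel (cnt + 1) (rest.drop (cnt / M + 1))
        (acc ++ boolPair (if fl ∧ cnt = q₀ then o else P.blockFn (rest.take (cnt / M + 1))) []) := by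
  obtain ⟨h0, h1, h2, h3, h4, h5, h6, h7, h8⟩ := sState_fields bud M fl q₀ o (fuel + 1) cnt rest acc
  have hnew : sNewFn P (sState bud M fl q₀ o (fuel + 1) cnt rest acc) =
      boolPair (if fl ∧ cnt = q₀ then o else P.blockFn (rest.take (cnt / M + 1))) [] := by
    simp only [sNewFn, Function.comp_apply, fanoutFn_apply, h0, outF_sState, takeFn_boolPair, List.length_replicate]
    exact List.take_of_length_le hlen
  unfold sRoundFn
  rw [fanoutFn_apply, iteFn_apply_false]
  · unfold sWorkFn
    simp only [fanoutFn_apply, Function.comp_apply, hnew, h0, h1, h2, h3, h4, h5, h6, h7, h8, lenFn_sState, dropFn_boolPair,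
      List.length_singleton, List.length_replicate, concatFn_boolPair]
    simp [sState, BProg.true_cons_ones, ones]
  · simp [sState, lenLeFn_boolPair, fstF, ones]

/-- `frames` of one more entry. [folklore] -/
theorem frames_take_succ {l : List (List Bool)} {t : ℕ} (ht : t < l.length) :
    frames (l.take (t + 1)) = frames (l.take t) ++ boolPair l[t] [] := by
  rw [List.take_add_one, List.getElem?_eq_getElem ht, Option.toList_some, frames_append, frames_cons_eq_boolPair, frames_nil]

/-- **Rounds of the splice loop** from the initial state: after `t ≤ M²` rounds, `t` frames are
emitted. [folklore] -/
theorem iterate_sRoundFn {w : List Bool}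
    (hbud : ∀ t (ht : t < M * M), (boolPair ((outsS P M fl q₀ o w)[t]'(by simpa using ht)) []).length ≤ bud) :
    ∀ t, t ≤ M * M → (sRoundFn P)^[t] (sState bud M fl q₀ o (M * M) 0 w []) =
      sState bud M fl q₀ o (M * M - t) t (w.drop ((lens M).take t).sum) (frames ((outsS P M fl q₀ o w).take t))
  | 0, _ => by simp
  | t + 1, ht => by
    have ht' : t < M * M := ht
    have hout := outsS_getElem P fl q₀ o w ht'
    rw [Function.iterate_succ_apply', iterate_sRoundFn hbud t ht'.le, show M * M - t = (M * M - (t + 1)) + 1 by omega,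
      sRoundFn_sState_succ _ _ _ _ _ _ _ _ _ (by rw [← hout]; exact hbud t ht'), List.drop_drop,
      frames_take_succ (by simpa using ht'), hout, List.sum_take_succ _ _ (by simpa using ht'), lens_getElem]

/-- Rounds beyond the fuel change nothing. [folklore] -/
theorem iterate_sRoundFn_of_zero (cnt : ℕ) (rest acc : List Bool) :
    ∀ j, (sRoundFn P)^[j] (sState bud M fl q₀ o 0 cnt rest acc) = sState bud M fl q₀ o 0 cnt rest acc
  | 0 => rfl
  | j + 1 => by rw [Function.iterate_succ_apply', iterate_sRoundFn_of_zero cnt rest acc j, sRoundFn_sState_zero]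

/-- **The splice loop emits all frames**, provided the budget dominates the frames and the number
of rounds `R ≥ M²`. [folklore] -/
theorem iterate_sRoundFn_all {w : List Bool} {R : ℕ} (hR : M * M ≤ R)
    (hbud : ∀ t (ht : t < M * M), (boolPair ((outsS P M fl q₀ o w)[t]'(by simpa using ht)) []).length ≤ bud) :
    sndPow 7 ((sRoundFn P)^[R] (sState bud M fl q₀ o (M * M) 0 w [])) = frames (outsS P M fl q₀ o w) := by
  have hsplit : (sRoundFn P)^[R] = (sRoundFn P)^[R - M * M] ∘ (sRoundFn P)^[M * M] := by
    rw [← Function.iterate_add, Nat.sub_add_cancel hR]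
  rw [hsplit, Function.comp_apply, iterate_sRoundFn _ _ _ _ _ hbud (M * M) le_rfl, Nat.sub_self, iterate_sRoundFn_of_zero,
    (sState_fields _ _ _ _ _ _ _ _ _).2.2.2.2.2.2.2.2, List.take_of_length_le (by simp)]

end Sem

/-! ### The splice pipeline and `F` -/

/-- `Λ` as a polynomial. [folklore] -/
def Λpoly (sf : Polynomial ℕ) : Polynomial ℕ := 2 * X + 2 + X * (2 * sf + 2)

/-- Value of `Λpoly`. [folklore] -/
@[simp] theorem Λpoly_eval (sf : Polynomial ℕ) (N : ℕ) : (Λpoly sf).eval N = Λof sf N := by simp [Λpoly, Λof]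

/-- **The splice pipeline** on a record `⟨1^{bud}, ⟨[fl], ⟨1^{q₀}, ⟨o, w⟩⟩⟩⟩`: the assembled value
`pad_{Λ(|w|)}(⟨1^{Mof |w|}, frames (spliced outputs)⟩)`. [folklore] -/
def spliceFn (sf : Polynomial ℕ) : List Bool → List Bool :=
  pad10Fn ∘ fanoutFn (polyFn (Λpoly sf) ∘ sndPow 3) (fanoutFn (mofFn ∘ sndPow 3)
    (sndPow 7 ∘ (fun z => (sRoundFn P)^[X.eval (boolUnpair z).1.length] z) ∘
      -- initial state from the record
      fanoutFn fstF (fanoutFn (mofFn ∘ sndPow 3) (fanoutFn (nthF 1) (fanoutFn (nthF 2) (fanoutFn (nthF 3)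
        (fanoutFn (polyFn (X ^ 2) ∘ mofFn ∘ sndPow 3) (fanoutFn (fun _ => []) (fanoutFn (sndPow 3) (fun _ => []))))))))))

/-- `spliceFn ∈ FP` when the block function is. [folklore] -/
theorem spliceFn_mem_FP (hb : P.blockFn ∈ FP) (sf : Polynomial ℕ) : spliceFn P sf ∈ FP := by
  have hm3 : mofFn ∘ sndPow 3 ∈ FP := comp_mem_FP mofFn_mem_FP (sndPow_mem_FP 3)
  have hinit : fanoutFn fstF (fanoutFn (mofFn ∘ sndPow 3) (fanoutFn (nthF 1) (fanoutFn (nthF 2) (fanoutFn (nthF 3)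
      (fanoutFn (polyFn (X ^ 2) ∘ mofFn ∘ sndPow 3) (fanoutFn (fun _ => []) (fanoutFn (sndPow 3) (fun _ => [])))))))) ∈ FP :=
    fanoutFn_mem_FP fstF_mem_FP (fanoutFn_mem_FP hm3 (fanoutFn_mem_FP (nthF_mem_FP 1) (fanoutFn_mem_FP (nthF_mem_FP 2)
      (fanoutFn_mem_FP (nthF_mem_FP 3) (fanoutFn_mem_FP (comp_mem_FP (polyFn_mem_FP _) hm3)
        (fanoutFn_mem_FP (const_mem_FP []) (fanoutFn_mem_FP (sndPow_mem_FP 3) (const_mem_FP []))))))))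
  have hloop := iterate_mem_FP_of_growth (sRoundFn_mem_FP P hb) 28 sRoundFn_fst length_sRoundFn_le X
  exact comp_mem_FP pad10Fn_mem_FP (fanoutFn_mem_FP (comp_mem_FP (polyFn_mem_FP _) (sndPow_mem_FP 3))
    (fanoutFn_mem_FP hm3 (comp_mem_FP (sndPow_mem_FP 7) (comp_mem_FP hloop hinit))))

/-- **The splice pipeline computes `assemble`** of the spliced outputs, provided the budget
dominates `M²` and every frame. [folklore] -/
theorem spliceFn_apply (sf : Polynomial ℕ) {bud : ℕ} {fl : Bool} {q₀ : ℕ} {o w : List Bool}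
    (hR : Mof w.length * Mof w.length ≤ bud)
    (hbud : ∀ t (ht : t < Mof w.length * Mof w.length), (boolPair ((outsS P (Mof w.length) fl q₀ o w)[t]'(by simpa using ht)) []).length ≤ bud) :
    spliceFn P sf (boolPair (ones bud) (boolPair [fl] (boolPair (ones q₀) (boolPair o w)))) =
      assemble sf w.length (outsS P (Mof w.length) fl q₀ o w) := by
  have hinit : (fanoutFn fstF (fanoutFn (mofFn ∘ sndPow 3) (fanoutFn (nthF 1) (fanoutFn (nthF 2) (fanoutFn (nthF 3)
      (fanoutFn (polyFn (X ^ 2) ∘ mofFn ∘ sndPow 3) (fanoutFn (fun _ => []) (fanoutFn (sndPow 3) (fun _ => []))))))))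
        (boolPair (ones bud) (boolPair [fl] (boolPair (ones q₀) (boolPair o w))))) =
      sState bud (Mof w.length) fl q₀ o (Mof w.length * Mof w.length) 0 w [] := by
    simp [sState, sq, ones]
  unfold spliceFn
  rw [Function.comp_apply, fanoutFn_apply, fanoutFn_apply]
  simp only [Function.comp_apply]
  rw [hinit, show sndPow 3 (boolPair (ones bud) (boolPair [fl] (boolPair (ones q₀) (boolPair o w)))) = w by simp,
    show (boolUnpair (sState bud (Mof w.length) fl q₀ o (Mof w.length * Mof w.length) 0 w [])).1.length = bud by simp [sState],
    eval_X, iterate_sRoundFn_all _ _ _ _ _ hR hbud]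
  simp [assemble, padTo, polyFn_apply, zeros]

/-- **`F` as a pipeline**: the splice pipeline with the flag off, budget `2 sf(|w|) + 2 + |w|²`. [folklore] -/
def FFn (sf : Polynomial ℕ) : List Bool → List Bool :=
  spliceFn P sf ∘ fanoutFn (polyFn (2 * sf + 2 + X ^ 2)) (fanoutFn (fun _ => [false]) (fanoutFn (fun _ => []) (fanoutFn (fun _ => []) id)))

/-- `FFn ∈ FP`. [folklore] -/
theorem FFn_mem_FP (hb : P.blockFn ∈ FP) (sf : Polynomial ℕ) : FFn P sf ∈ FP :=
  comp_mem_FP (spliceFn_mem_FP P hb sf) (fanoutFn_mem_FP (polyFn_mem_FP _) (fanoutFn_mem_FP (const_mem_FP _)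
    (fanoutFn_mem_FP (const_mem_FP _) (fanoutFn_mem_FP (const_mem_FP _) OracleCompose.id_mem_FP))))

/-- **The pipeline computes `F`** when `sf` bounds the block outputs. [folklore] -/
theorem FFn_eq {sf : Polynomial ℕ} (hsf : ∀ u, (P.blockFn u).length ≤ sf.eval u.length) (w : List Bool) :
    FFn P sf w = P.F sf w := by
  have hM2 : Mof w.length * Mof w.length ≤ w.length ^ 2 := by
    have : Mof w.length ≤ w.length := Nat.findGreatest_le _
    rw [sq]; exact Nat.mul_le_mul this this
  have hout : outsS P (Mof w.length) false 0 [] w = (blocks w).map P.blockFn := by simp [outsS, blocks]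
  have hbud : ∀ t (ht : t < Mof w.length * Mof w.length),
      (boolPair ((outsS P (Mof w.length) false 0 [] w)[t]'(by simpa using ht)) []).length ≤ (2 * sf + 2 + X ^ 2).eval w.length := by
    intro t ht
    simp only [hout, eval_add, eval_mul, eval_ofNat, eval_pow, eval_X, length_boolPair, List.length_nil, add_zero]
    rw [List.getElem_map]
    have hx : (blocks w)[t]'(by simpa using ht) ∈ blocks w := List.getElem_mem _
    have h1 := hsf ((blocks w)[t]'(by simpa using ht))
    have h2 := natPoly_eval_mono sf (length_of_mem_blocks hx)
    omega
  have h : spliceFn P sf (boolPair (ones ((2 * sf + 2 + X ^ 2).eval w.length)) (boolPair [false] (boolPair [] (boolPair [] w)))) =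
      assemble sf w.length (outsS P (Mof w.length) false 0 [] w) :=
    spliceFn_apply P sf (q₀ := 0) (by simp; omega) hbud
  unfold FFn
  rw [Function.comp_apply]
  simp only [fanoutFn_apply, polyFn_apply, id]
  rw [h, hout]
  rfl

end FProg

/-- **`F ∈ FP`**: the candidate one-way function is polynomial-time computable, for an efficient
scheme and any bound `sf` on the block outputs. [Goldreich 2001, §2.3.1] [folklore] -/
theorem F_mem_FP (P : Params) (hG : P.S.keyGen.IsPolyTime unaryEncodeNat (id : List Bool → List Bool))
    (hE : P.S.enc.IsPolyTime pairCode (id : List Bool → List Bool)) {sf : Polynomial ℕ}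
    (hsf : ∀ u, (P.blockFn u).length ≤ sf.eval u.length) : P.F sf ∈ FP := by
  have hfun : P.F sf = FProg.FFn P sf := funext fun w => (FProg.FFn_eq P hsf w).symm
  rw [hfun]
  exact FProg.FFn_mem_FP P (blockFn_mem_FP P hG hE) sf

end

end SKEOWF

end Literature.Computability.Cryptography


/-!
# Private-key encryption ⇒ one-way functions, IX: the distinguisher is polynomial-time

Ninth file of the discharge of `OWFExist_of_secureSKEExist` (Impagliazzo–Luby 1989, Thm. 1); see
`SchemesOWF.lean`, Part I (architecture), `SchemesOWF.lean`, Part VI (`Drun`, `DcoreRaw`) and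
`SchemesOWFProgram.lean`, Part VIII (the splice pipeline `FProg.spliceFn`). The run function `Drun P sf A Bd`
of the distinguisher is written as a pipeline of plumbing bricks on the input `⟨⟨u, v⟩, r⟩`:
decode the advice `(N, q, off, j*, κ)` from `|r| - Bd(|u|)^6` (`modLenFn`, `divModFn`), cut
`w = r ↾ N`, `r_A`, the spare coin `e`, build the splice `y = Fsplice_q(⟨1^{j*}, v⟩, w)`
(`FProg.spliceFn`), run `A` (`aRunFn`, from `IsPPT A` by `PolyTimeComputable.comp_holds`), read the
window `z[off, off + j*)`, and branch (`iteFn`) on "`f(window) = ⟨1^{j*}, v⟩`" between the window's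
first bit and `e`. Main results: `DProg.drunFn_boolPair` (the pipeline computes `[Drun … x r]`),
`drun_polyTime` (the machine fact `hD` of `Params.isOneWay_F`).

## References

* O. Goldreich, *Foundations of Cryptography I*, CUP 2001, §3.8 Exercise 11 (the distinguisher),
  §2.3.1.
* S. Arora, B. Barak, *Computational Complexity: A Modern Approach*, CUP 2009, §1.3, §1.4.1, §7.1.
-/

namespace Literature.Computability.Cryptography

namespace SKEOWF

open _root_.Computability Polynomial Complexity Complexity.Plumb Complexity.Brick Complexity.OracleCompose

noncomputable section

/-- `A` as a string function `⟨q, r⟩ ↦ A(q; r)`. [Arora–Barak 2009, §7.1] [folklore] -/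
def aRunFn (A : RandAlg (List Bool) (List Bool)) : List Bool → List Bool := Function.uncurry A.run ∘ boolUnpair

/-- Value of `aRunFn` on a pair. [folklore] -/
@[simp] theorem aRunFn_boolPair (A : RandAlg (List Bool) (List Bool)) (q r : List Bool) : aRunFn A (boolPair q r) = A.run q r := by
  simp [aRunFn]

/-- `aRunFn ∈ FP` for a PPT `A`. [Arora–Barak 2009, §7.1, §1.3] [folklore] -/
theorem aRunFn_mem_FP {A : RandAlg (List Bool) (List Bool)} (hA : IsPPT A id) : aRunFn A ∈ FP :=
  PolyTimeComputable.comp_holds (by simpa using hA.1) polyTimeComputable_boolUnpair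

namespace DProg

variable (P : Params) (sf Bd : Polynomial ℕ) (A : RandAlg (List Bool) (List Bool))

/-! ### Bricks on the input `z = ⟨⟨u, v⟩, r⟩` -/

/-- `u`. [folklore] -/
def uF : List Bool → List Bool := fstF ∘ fstF
/-- `v`. [folklore] -/
def vF : List Bool → List Bool := sndF ∘ fstF
/-- `1^{Bd(|u|)}`. [folklore] -/
def bdF : List Bool → List Bool := polyFn Bd ∘ uF
/-- `1^{Bd(|u|)^k}`. [folklore] -/
def bdPowF (k : ℕ) : List Bool → List Bool := polyFn (Bd ^ k) ∘ uF
/-- `1^{a}`, `a = |r| - Bd(|u|)^6`. [folklore] -/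
def aF : List Bool → List Bool := onesFn ∘ dropFn ∘ fanoutFn (bdPowF Bd 6) sndF
/-- `1^{N}`, `N = a mod Bd`. [folklore] -/
def nF : List Bool → List Bool := modLenFn ∘ fanoutFn (bdF Bd) (aF Bd)
/-- `1^{(a / Bd^k) mod Bd}`. [folklore] -/
def digF (k : ℕ) : List Bool → List Bool := modLenFn ∘ fanoutFn (bdF Bd) (fstF ∘ divModFn ∘ fanoutFn (bdPowF Bd k) (aF Bd))
/-- `1^{κ}`, `κ = a / Bd^4`. [folklore] -/
def kapF : List Bool → List Bool := fstF ∘ divModFn ∘ fanoutFn (bdPowF Bd 4) (aF Bd)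
/-- `w = r ↾ N`. [folklore] -/
def wF : List Bool → List Bool := takeFn ∘ fanoutFn (nF Bd) sndF
/-- `r_A = (r ⇂ N) ↾ κ`. [folklore] -/
def rAF : List Bool → List Bool := takeFn ∘ fanoutFn (kapF Bd) (dropFn ∘ fanoutFn (nF Bd) sndF)
/-- The spare coin as a bit string `[e]`, `e = (r ⇂ (N + κ)).headD 0`. [folklore] -/
def eF : List Bool → List Bool :=
  eqPairFn ∘ fanoutFn (takeFn ∘ fanoutFn (fun _ => ones 1) (dropFn ∘ fanoutFn (concatFn ∘ fanoutFn (nF Bd) (kapF Bd)) sndF)) (fun _ => [true])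
/-- The tagged challenge `⟨1^{j*}, v⟩`. [folklore] -/
def tagF : List Bool → List Bool := fanoutFn (digF Bd 3) vF
/-- The budget of the splice loop: `2 sf(|z|) + 2 + |z|² + 2 (2 Bd(|z|) + 2 + |z|) + 2`. [folklore] -/
def budPoly : Polynomial ℕ := 2 * sf + 2 + X ^ 2 + 2 * (2 * Bd + 2 + X) + 2
/-- The splice `y = Fsplice_q(⟨1^{j*}, v⟩, w)`. [folklore] -/
def yF : List Bool → List Bool :=
  FProg.spliceFn P sf ∘ fanoutFn (polyFn (budPoly sf Bd)) (fanoutFn (fun _ => [true]) (fanoutFn (digF Bd 1) (fanoutFn (tagF Bd) (wF Bd))))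
/-- `A`'s answer `z' = A(1^N, y; r_A)`. [folklore] -/
def zF : List Bool → List Bool := aRunFn A ∘ fanoutFn (fanoutFn (nF Bd) (yF P sf Bd)) (rAF Bd)
/-- The window `z'[off, off + j*)`. [folklore] -/
def winF : List Bool → List Bool := takeFn ∘ fanoutFn (digF Bd 3) (dropFn ∘ fanoutFn (digF Bd 2) (zF P sf Bd A))
/-- The test bit `[f(window) = ⟨1^{j*}, v⟩]`. [folklore] -/
def testF : List Bool → List Bool := eqPairFn ∘ fanoutFn (P.blockFn ∘ winF P sf Bd A) (tagF Bd)
/-- The window's first bit, as a bit string. [folklore] -/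
def hbF : List Bool → List Bool := eqPairFn ∘ fanoutFn (takeFn ∘ fanoutFn (fun _ => ones 1) (winF P sf Bd A)) (fun _ => [true])
/-- **The run function of the distinguisher as a pipeline.** [folklore] -/
def drunFn : List Bool → List Bool := iteFn (testF P sf Bd A) (hbF P sf Bd A) (eF Bd)

/-! ### `FP` membership -/

/-- `drunFn ∈ FP` (for an efficient scheme and a PPT `A`). [folklore] -/
theorem drunFn_mem_FP (hb : P.blockFn ∈ FP) (hA : IsPPT A id) : drunFn P sf Bd A ∈ FP := by
  have hu : uF ∈ FP := comp_mem_FP fstF_mem_FP fstF_mem_FP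
  have hv : vF ∈ FP := comp_mem_FP sndF_mem_FP fstF_mem_FP
  have hbd : bdF Bd ∈ FP := comp_mem_FP (polyFn_mem_FP _) hu
  have hbdp : ∀ k, bdPowF Bd k ∈ FP := fun k => comp_mem_FP (polyFn_mem_FP _) hu
  have ha : aF Bd ∈ FP := comp_mem_FP onesFn_mem_FP (comp_mem_FP dropFn_mem_FP (fanoutFn_mem_FP (hbdp 6) sndF_mem_FP))
  have hn : nF Bd ∈ FP := comp_mem_FP modLenFn_mem_FP (fanoutFn_mem_FP hbd ha)
  have hdig : ∀ k, digF Bd k ∈ FP := fun k => comp_mem_FP modLenFn_mem_FP (fanoutFn_mem_FP hbd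
    (comp_mem_FP fstF_mem_FP (comp_mem_FP divModFn_mem_FP (fanoutFn_mem_FP (hbdp k) ha))))
  have hkap : kapF Bd ∈ FP := comp_mem_FP fstF_mem_FP (comp_mem_FP divModFn_mem_FP (fanoutFn_mem_FP (hbdp 4) ha))
  have hw : wF Bd ∈ FP := comp_mem_FP takeFn_mem_FP (fanoutFn_mem_FP hn sndF_mem_FP)
  have hrA : rAF Bd ∈ FP := comp_mem_FP takeFn_mem_FP (fanoutFn_mem_FP hkap (comp_mem_FP dropFn_mem_FP (fanoutFn_mem_FP hn sndF_mem_FP)))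
  have he : eF Bd ∈ FP := comp_mem_FP eqPairFn_mem_FP (fanoutFn_mem_FP (comp_mem_FP takeFn_mem_FP (fanoutFn_mem_FP (const_mem_FP _)
    (comp_mem_FP dropFn_mem_FP (fanoutFn_mem_FP (comp_mem_FP concatFn_mem_FP (fanoutFn_mem_FP hn hkap)) sndF_mem_FP)))) (const_mem_FP _))
  have htag : tagF Bd ∈ FP := fanoutFn_mem_FP (hdig 3) hv
  have hy : yF P sf Bd ∈ FP := comp_mem_FP (FProg.spliceFn_mem_FP P hb sf) (fanoutFn_mem_FP (polyFn_mem_FP _)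
    (fanoutFn_mem_FP (const_mem_FP _) (fanoutFn_mem_FP (hdig 1) (fanoutFn_mem_FP htag hw))))
  have hz : zF P sf Bd A ∈ FP := comp_mem_FP (aRunFn_mem_FP hA) (fanoutFn_mem_FP (fanoutFn_mem_FP hn hy) hrA)
  have hwin : winF P sf Bd A ∈ FP := comp_mem_FP takeFn_mem_FP (fanoutFn_mem_FP (hdig 3) (comp_mem_FP dropFn_mem_FP (fanoutFn_mem_FP (hdig 2) hz)))
  have htest : testF P sf Bd A ∈ FP := comp_mem_FP eqPairFn_mem_FP (fanoutFn_mem_FP (comp_mem_FP hb hwin) htag)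
  have hhb : hbF P sf Bd A ∈ FP := comp_mem_FP eqPairFn_mem_FP (fanoutFn_mem_FP (comp_mem_FP takeFn_mem_FP (fanoutFn_mem_FP (const_mem_FP _) hwin)) (const_mem_FP _))
  exact iteFn_mem_FP htest hhb he

/-! ### Semantics -/

section Sem

variable (x r : List Bool)

/-- The decoded base `Bd(|u|)`. [folklore] -/
abbrev bdV : ℕ := Bd.eval (boolUnpair x).1.length
/-- The number `a = |r| - Bd^6`. [folklore] -/
abbrev aV : ℕ := r.length - bdV Bd x ^ 6

/-- Value of `uF`. [folklore] -/
@[simp] theorem uF_apply : uF (boolPair x r) = (boolUnpair x).1 := by simp [uF, fstF]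
/-- Value of `vF`. [folklore] -/
@[simp] theorem vF_apply : vF (boolPair x r) = (boolUnpair x).2 := by simp [vF, fstF, sndF]
/-- Value of `bdF`. [folklore] -/
@[simp] theorem bdF_apply : bdF Bd (boolPair x r) = ones (bdV Bd x) := by simp [bdF]
/-- Value of `bdPowF`. [folklore] -/
@[simp] theorem bdPowF_apply (k : ℕ) : bdPowF Bd k (boolPair x r) = ones (bdV Bd x ^ k) := by simp [bdPowF]
/-- Value of `aF`. [folklore] -/
@[simp] theorem aF_apply : aF Bd (boolPair x r) = ones (aV Bd x r) := by simp [aF, onesFn, unaryEncodeNat_eq_ones]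
/-- Value of `nF`. [folklore] -/
@[simp] theorem nF_apply : nF Bd (boolPair x r) = ones (aV Bd x r % bdV Bd x) := by simp [nF, modLenFn_boolPair]
/-- Value of `digF`. [folklore] -/
@[simp] theorem digF_apply (k : ℕ) : digF Bd k (boolPair x r) = ones (aV Bd x r / bdV Bd x ^ k % bdV Bd x) := by
  simp [digF, modLenFn_boolPair, divModFn_boolPair]
/-- Value of `kapF`. [folklore] -/
@[simp] theorem kapF_apply : kapF Bd (boolPair x r) = ones (aV Bd x r / bdV Bd x ^ 4) := by simp [kapF, divModFn_boolPair]
/-- Value of `wF`. [folklore] -/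
@[simp] theorem wF_apply : wF Bd (boolPair x r) = r.take (aV Bd x r % bdV Bd x) := by simp [wF]
/-- Value of `rAF`. [folklore] -/
@[simp] theorem rAF_apply : rAF Bd (boolPair x r) = (r.drop (aV Bd x r % bdV Bd x)).take (aV Bd x r / bdV Bd x ^ 4) := by simp [rAF]
/-- Value of `eF`. [folklore] -/
@[simp] theorem eF_apply : eF Bd (boolPair x r) = [(r.drop (aV Bd x r % bdV Bd x + aV Bd x r / bdV Bd x ^ 4)).headD false] := by
  simp only [eF, Function.comp_apply, fanoutFn_apply, nF_apply, kapF_apply, concatFn_boolPair, sndF_boolPair, dropFn_boolPair,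
    List.length_append, List.length_replicate, takeFn_boolPair, eqPairFn_boolPair]
  cases r.drop (aV Bd x r % bdV Bd x + aV Bd x r / bdV Bd x ^ 4) with
  | nil => rfl
  | cons b l => cases b <;> rfl
/-- Value of `tagF`. [folklore] -/
@[simp] theorem tagF_apply : tagF Bd (boolPair x r) = boolPair (ones (aV Bd x r / bdV Bd x ^ 3 % bdV Bd x)) (boolUnpair x).2 := by
  simp [tagF]

/-- **Value of `yF`: the splice** `Fsplice_q(⟨1^{j*}, v⟩, w)`. [folklore] -/
theorem yF_apply (hsf : ∀ u, (P.blockFn u).length ≤ sf.eval u.length) :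
    yF P sf Bd (boolPair x r) = P.Fsplice sf (aV Bd x r / bdV Bd x % bdV Bd x)
      (boolPair (ones (aV Bd x r / bdV Bd x ^ 3 % bdV Bd x)) (boolUnpair x).2) (r.take (aV Bd x r % bdV Bd x)) := by
  set w := r.take (aV Bd x r % bdV Bd x) with hw
  set q₀ := aV Bd x r / bdV Bd x % bdV Bd x with hq₀
  set tag := boolPair (ones (aV Bd x r / bdV Bd x ^ 3 % bdV Bd x)) (boolUnpair x).2 with htag
  set bud := (budPoly sf Bd).eval (boolPair x r).length with hbud
  have hz : x.length ≤ (boolPair x r).length := by rw [length_boolPair]; omega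
  have hux : (boolUnpair x).1.length ≤ x.length := (length_boolUnpair_parts_le x).trans' (by omega)
  have hvx : (boolUnpair x).2.length ≤ x.length := (length_boolUnpair_parts_le x).trans' (by omega)
  have hwz : w.length ≤ (boolPair x r).length := by rw [hw, List.length_take, length_boolPair]; omega
  have hBd : bdV Bd x ≤ Bd.eval (boolPair x r).length := natPoly_eval_mono _ (hux.trans hz)
  have hBpos : 0 < bdV Bd x ∨ bdV Bd x = 0 := by omega
  have hM : Mof w.length ≤ w.length := Nat.findGreatest_le _
  have hM2 : Mof w.length * Mof w.length ≤ (boolPair x r).length ^ 2 := by rw [sq]; exact Nat.mul_le_mul (hM.trans hwz) (hM.trans hwz)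
  have hjj : aV Bd x r / bdV Bd x ^ 3 % bdV Bd x ≤ Bd.eval (boolPair x r).length := by
    rcases hBpos with h | h
    · exact (Nat.mod_lt _ h).le.trans hBd
    · rw [h]; simp
  have hout : FProg.outsS P (Mof w.length) true q₀ tag w = ((blocks w).map P.blockFn).set q₀ tag := by simp [FProg.outsS, blocks]
  have hbudok : ∀ t (ht : t < Mof w.length * Mof w.length),
      (boolPair ((FProg.outsS P (Mof w.length) true q₀ tag w)[t]'(by simpa using ht)) []).length ≤ bud := by
    intro t ht
    rw [length_boolPair, List.length_nil, add_zero, hbud, budPoly]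
    simp only [eval_add, eval_mul, eval_ofNat, eval_pow, eval_X]
    rw [List.getElem_of_eq hout]
    by_cases hq : q₀ = t
    · subst hq
      rw [List.getElem_set_self, htag, length_boolPair, List.length_replicate]
      have := hvx.trans hz
      omega
    · rw [List.getElem_set_ne hq, List.getElem_map]
      have hx' : (blocks w)[t]'(by simpa using ht) ∈ blocks w := List.getElem_mem _
      have h1 := hsf ((blocks w)[t]'(by simpa using ht))
      have h2 := natPoly_eval_mono sf ((length_of_mem_blocks hx').trans hwz)
      omega
  have happ := FProg.spliceFn_apply P sf (fl := true) (q₀ := q₀) (o := tag) (w := w) (bud := bud)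
    (hM2.trans (by rw [hbud, budPoly]; simp only [eval_add, eval_mul, eval_ofNat, eval_pow, eval_X]; omega)) hbudok
  unfold yF
  rw [Function.comp_apply]
  simp only [fanoutFn_apply, polyFn_apply, digF_apply, tagF_apply, wF_apply]
  rw [pow_one, happ, hout]
  rfl

/-- Value of `zF`. [folklore] -/
theorem zF_apply (hsf : ∀ u, (P.blockFn u).length ≤ sf.eval u.length) :
    zF P sf Bd A (boolPair x r) = A.run (boolPair (unaryEncodeNat (aV Bd x r % bdV Bd x))
      (P.Fsplice sf (aV Bd x r / bdV Bd x % bdV Bd x) (boolPair (ones (aV Bd x r / bdV Bd x ^ 3 % bdV Bd x)) (boolUnpair x).2)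
        (r.take (aV Bd x r % bdV Bd x)))) ((r.drop (aV Bd x r % bdV Bd x)).take (aV Bd x r / bdV Bd x ^ 4)) := by
  simp only [zF, Function.comp_apply, fanoutFn_apply, nF_apply, yF_apply P sf Bd x r hsf, rAF_apply, aRunFn_boolPair, unaryEncodeNat_eq_ones]

/-- **The pipeline computes the run function of the distinguisher**: `drunFn ⟨x, r⟩ = [Drun x r]`. [folklore] -/
theorem drunFn_boolPair (hsf : ∀ u, (P.blockFn u).length ≤ sf.eval u.length) :
    drunFn P sf Bd A (boolPair x r) = [Drun P sf A Bd x r] := by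
  have hwin : winF P sf Bd A (boolPair x r) = ((zF P sf Bd A (boolPair x r)).drop (aV Bd x r / bdV Bd x ^ 2 % bdV Bd x)).take
      (aV Bd x r / bdV Bd x ^ 3 % bdV Bd x) := by
    simp only [winF, Function.comp_apply, fanoutFn_apply, digF_apply, dropFn_boolPair, takeFn_boolPair, List.length_replicate]
  have htest : testF P sf Bd A (boolPair x r) = [decide (P.blockFn (winF P sf Bd A (boolPair x r)) =
      boolPair (ones (aV Bd x r / bdV Bd x ^ 3 % bdV Bd x)) (boolUnpair x).2)] := by
    simp only [testF, Function.comp_apply, fanoutFn_apply, tagF_apply, eqPairFn_boolPair]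
  have hhb : hbF P sf Bd A (boolPair x r) = [(winF P sf Bd A (boolPair x r)).headD false] := by
    simp only [hbF, Function.comp_apply, fanoutFn_apply, takeFn_boolPair, List.length_replicate, eqPairFn_boolPair]
    cases winF P sf Bd A (boolPair x r) with
    | nil => rfl
    | cons b l => cases b <;> rfl
  unfold drunFn Drun DcoreRaw
  rw [← zF_apply P sf Bd A x r hsf, ← hwin]
  by_cases h : P.blockFn (winF P sf Bd A (boolPair x r)) = boolPair (ones (aV Bd x r / bdV Bd x ^ 3 % bdV Bd x)) (boolUnpair x).2
  · rw [iteFn_apply_true (by rw [htest, decide_eq_true h]), if_pos h, hhb]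
  · rw [iteFn_apply_false (by rw [htest, decide_eq_false h]), if_neg h, eF_apply]

end Sem

end DProg

/-- **The machine fact `hD` of `Params.isOneWay_F`**: the run function of the distinguisher is
polynomial-time, for every PPT inverter `A` and every advice base `Bd`. [Goldreich 2001, §3.8
Exercise 11 ("a probabilistic polynomial-time distinguisher")] [folklore] -/
theorem drun_polyTime (P : Params) (hG : P.S.keyGen.IsPolyTime unaryEncodeNat (id : List Bool → List Bool))
    (hE : P.S.enc.IsPolyTime pairCode (id : List Bool → List Bool)) {sf : Polynomial ℕ}
    (hsf : ∀ u, (P.blockFn u).length ≤ sf.eval u.length)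
    (A : RandAlg (List Bool) (List Bool)) (hA : IsPPT A id) (Bd : Polynomial ℕ) :
    PolyTimeComputable (fun p : List Bool × List Bool => boolPair p.1 p.2) encodeBool (Function.uncurry (Drun P sf A Bd)) := by
  obtain ⟨p, M, hM⟩ := DProg.drunFn_mem_FP P sf Bd A (blockFn_mem_FP P hG hE) hA
  refine ⟨p, M, fun q => ?_⟩
  have h := hM (boolPair q.1 q.2)
  rw [id, DProg.drunFn_boolPair P sf Bd A q.1 q.2 hsf] at h
  exact h

end

end SKEOWF

end Literature.Computability.Cryptography
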